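import Literature.NumberTheory.EllipticCurves.HyperbolicBandIntegralProofs
import Literature.NumberTheory.EllipticCurves.ModularParametrizationDegreeProofs
import HarnessLib

/-!
# The potential of the dual form of a closed geodesic on `X₀(N)`

Definitions and theorems (no named facts). Fifth brick of the proof of Riemann's period
relations for `X₀(N)` in Petersson form (hypothesis `hRB` of
`PastenSpectralDegreeHomologyProofs.lean`). For a hyperbolic `δ₀ ∈ Γ₀(N)` with adapted coordinate
`w` (`w(δ₀z) = κ w(z)`, `HyperbolicBandIntegralProofs`) and the smooth step
`B₀ = b ∘ arg ∘ w` across its axis (Farkas–Kra II.3.3: the closed form `η_c = df` dual to a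
simple closed curve `c`, `f` a step across `c` inside an annulus), we construct on `ℍ` the
potential `U(τ) = ∑_{c ∈ Γ₀(N)/A₀} (B₀(g_c⁻¹τ) - B₀(g_c⁻¹τ₀))` (`A₀ = {±δ₀ⁿ}`, `dualPotential`) of the
lift of the dual form of the closed geodesic of `δ₀` on `X₀(N)`, and prove:

* `DualForm.finite_support_cosetTerm_sub` — the sum is finite (proper discontinuity);
* `DualForm.dualPotential_smul` — quasi-periodicity `U(γτ) = U(τ) + p(γ)`, `γ ∈ Γ₀(N)`, with
  additive periods `p` (`dualPeriod_mul`) independent of the base point (`dualPeriod_eq`);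
* `DualForm.exists_int_dualPeriod_eq` — **`p(γ) ∈ ℤ`** (Farkas–Kra III.1.1: the periods of the dual
  form are intersection numbers), by evaluating at a point above all translates of the band
  (`exists_height_bound`);
* `DualForm.dualPotential_eq_of_height` — `U` is constant on the horoballs `s·{im > Y₀}` at every
  cusp;
* `DualForm.hasFDerivAt_dualPotential`, `continuousOn_dualPotentialDeriv` — `U` is real-`C¹` with
  derivative `U' = ∑_c (B₀ ∘ g_c⁻¹)'` (`dualPotentialDeriv`, locally a finite sum);
* `DualForm.tsum_periodisation_eq` — the `Γ₀(N)`-periodisation of the cut-off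
  `𝟙_{[0,|ℓ|)}(log|w|) · 2∂B₀/∂z̄ dz̄` is `2 ∂U/∂z̄` (grouping `Γ₀(N) = ⨆_c A₀ g_c⁻¹`,
  `tsum_indicator_axisSubgroup`).

## References

* [FarkasKra1992] H. M. Farkas, I. Kra, *Riemann Surfaces*, 2nd ed., GTM 71 (1992): II.3.3
  (the closed differential dual to a closed curve), III.1.1 (its periods).
-/

noncomputable section

open MeasureTheory Set Filter Topology Complex CongruenceSubgroup
open scoped ComplexConjugate UpperHalfPlane MatrixGroups ModularForm Real

namespace Literature.NumberTheory.EllipticCurves.ModularForms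

namespace DualForm

variable {N : ℕ}

/-! ### The subgroup `A₀ = {±δ₀ⁿ}` of `Γ₀(N)` -/

/-- The element `-1` of `Γ₀(N)` (`-1 ∈ Γ₀(N)`: the tree's `HaberlandAlgebra.neg_one_mem_Gamma0`,
re-derived inline to keep the import closure small). [folklore] -/
def negOne : Gamma0 N := ⟨-1, by simp [Gamma0_mem]⟩

/-- `negOne` is `-1`. [folklore] -/
@[simp] theorem coe_negOne : ((negOne : Gamma0 N) : SL(2, ℤ)) = -1 := rfl

/-- `-1` is central. [folklore] -/
theorem negOne_mul_comm (a : Gamma0 N) : negOne * a = a * negOne := by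
  ext : 1; simp

/-- `(-1)² = 1`. [folklore] -/
@[simp] theorem negOne_mul_negOne : (negOne : Gamma0 N) * negOne = 1 := by
  ext : 1; simp

/-- **The subgroup `A₀ = {δ₀ⁿ, -δ₀ⁿ : n ∈ ℤ}`** of `Γ₀(N)` generated by `δ₀` and `-1` (the
stabiliser, up to finite index, of the axis of a hyperbolic `δ₀`). [folklore] -/
def axisSubgroup (δ₀ : Gamma0 N) : Subgroup (Gamma0 N) where
  carrier := {a | ∃ n : ℤ, a = δ₀ ^ n ∨ a = negOne * δ₀ ^ n}
  mul_mem' := by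
    rintro a b ⟨m, hm⟩ ⟨n, hn⟩
    refine ⟨m + n, ?_⟩
    rcases hm with rfl | rfl <;> rcases hn with rfl | rfl
    · left; rw [zpow_add]
    · right; rw [← mul_assoc, ← negOne_mul_comm, mul_assoc, zpow_add]
    · right; rw [mul_assoc, zpow_add]
    · left
      rw [mul_assoc, ← mul_assoc (δ₀ ^ m), ← negOne_mul_comm, mul_assoc, ← mul_assoc,
        negOne_mul_negOne, one_mul, zpow_add]
  one_mem' := ⟨0, Or.inl (by simp)⟩
  inv_mem' := by
    rintro a ⟨n, hn⟩
    refine ⟨-n, ?_⟩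
    rcases hn with rfl | rfl
    · left; rw [zpow_neg]
    · right
      rw [mul_inv_rev, zpow_neg]
      have : (negOne : Gamma0 N)⁻¹ = negOne := by
        rw [inv_eq_iff_mul_eq_one, negOne_mul_negOne]
      rw [this, negOne_mul_comm]

/-- Membership in `A₀`. [folklore] -/
theorem mem_axisSubgroup_iff {δ₀ a : Gamma0 N} :
    a ∈ axisSubgroup δ₀ ↔ ∃ n : ℤ, a = δ₀ ^ n ∨ a = negOne * δ₀ ^ n := Iff.rfl

/-- `δ₀ ∈ A₀`. [folklore] -/
theorem self_mem_axisSubgroup (δ₀ : Gamma0 N) : δ₀ ∈ axisSubgroup δ₀ := ⟨1, Or.inl (by simp)⟩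

/-- `-1 ∈ A₀`. [folklore] -/
theorem negOne_mem_axisSubgroup (δ₀ : Gamma0 N) : negOne ∈ axisSubgroup δ₀ := ⟨0, Or.inr (by simp)⟩

/-! ### The band function of the angle and the coset terms -/

/-- **`B₀(z) = b(arg w(z))`**: the smooth step `b(θ) = smoothTransition((θ - (π/2-ε))/(2ε))`
across the axis `arg w = π/2` of the coordinate `w = (z-ξ₁)/(z-ξ₂)`; `B₀ = 0` on the side
`arg w ≤ π/2 - ε`, `= 1` on the side `arg w ≥ π/2 + ε` (Farkas–Kra II.3.3: the function `f` equal
to `1` on one side of the curve inside an annulus and `0` outside). [cite: FarkasKra1992, II.3.3] -/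
def bandAngle (ξ₁ ξ₂ ε : ℝ) (z : ℂ) : ℝ :=
  Real.smoothTransition ((Complex.arg ((z - ξ₁) / (z - ξ₂)) - (π / 2 - ε)) / (2 * ε))

/-- The **coset term** `T_τ(c) = B₀(g⁻¹ τ)` for `c = gA₀ ∈ Γ₀(N)/A₀` (through the representative
`c.out`; independent of it when `B₀` is `A₀`-invariant, `cosetTerm_mk`). [folklore] -/
def cosetTerm (δ₀ : Gamma0 N) (ξ₁ ξ₂ ε : ℝ) (τ : ℍ) (c : Gamma0 N ⧸ axisSubgroup δ₀) : ℝ :=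
  bandAngle ξ₁ ξ₂ ε (((((Quotient.out c : Gamma0 N)) : SL(2, ℤ))⁻¹ • τ : ℍ) : ℂ)

/-- The **potential of the dual form** of the closed geodesic of `δ₀` (Farkas–Kra II.3.3, lifted to
`ℍ` and summed over `Γ₀(N)/A₀`): `U(τ) = ∑_c (T_τ(c) - T_{τ₀}(c))`, a finite sum for each `τ`
(`finite_support_cosetTerm_sub`). [cite: FarkasKra1992, II.3.3] -/
def dualPotential (δ₀ : Gamma0 N) (ξ₁ ξ₂ ε : ℝ) (τ₀ τ : ℍ) : ℝ :=
  ∑ᶠ c, (cosetTerm δ₀ ξ₁ ξ₂ ε τ c - cosetTerm δ₀ ξ₁ ξ₂ ε τ₀ c)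

/-- The **periods** `p(γ) = U(γτ₀) = U(γτ) - U(τ)` of the dual form. [folklore] -/
def dualPeriod (δ₀ : Gamma0 N) (ξ₁ ξ₂ ε : ℝ) (τ₀ : ℍ) (γ : Gamma0 N) : ℝ :=
  dualPotential δ₀ ξ₁ ξ₂ ε τ₀ ((γ : SL(2, ℤ)) • τ₀)

section Invariance

variable {ξ₁ ξ₂ κ ε : ℝ} {δ₀ : Gamma0 N}

/-- `↑(g • τ) = moebius g ↑τ`. [folklore] -/
theorem coe_smul_eq_moebius (g : SL(2, ℤ)) (τ : ℍ) : ((g • τ : ℍ) : ℂ) = moebius g (τ : ℂ) := by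
  rw [← UpperHalfPlane.ofComplex_apply τ, coe_smul_ofComplex g τ.im_pos, UpperHalfPlane.ofComplex_apply]

/-- **`B₀` is invariant under `δ₀`**: `B₀(δ₀ τ) = B₀(τ)` (`arg w(δz) = arg w(z)`). [folklore] -/
theorem bandAngle_smul_self (hξ : ξ₂ < ξ₁) (hκ : 0 < κ)
    (hw : ∀ z : ℂ, 0 < z.im →
      (moebius (δ₀ : SL(2, ℤ)) z - ξ₁) / (moebius (δ₀ : SL(2, ℤ)) z - ξ₂) = κ * ((z - ξ₁) / (z - ξ₂)))
    (τ : ℍ) : bandAngle ξ₁ ξ₂ ε ((((δ₀ : SL(2, ℤ)) • τ : ℍ)) : ℂ) = bandAngle ξ₁ ξ₂ ε (τ : ℂ) := by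
  simp only [bandAngle, coe_smul_eq_moebius, HypStrip.arg_w_moebius hξ hκ hw τ.im_pos]

/-- **`B₀` is invariant under `A₀`.** [folklore] -/
theorem bandAngle_smul_of_mem (hξ : ξ₂ < ξ₁) (hκ : 0 < κ)
    (hw : ∀ z : ℂ, 0 < z.im →
      (moebius (δ₀ : SL(2, ℤ)) z - ξ₁) / (moebius (δ₀ : SL(2, ℤ)) z - ξ₂) = κ * ((z - ξ₁) / (z - ξ₂)))
    {a : Gamma0 N} (ha : a ∈ axisSubgroup δ₀) (τ : ℍ) :
    bandAngle ξ₁ ξ₂ ε ((((a : SL(2, ℤ)) • τ : ℍ)) : ℂ) = bandAngle ξ₁ ξ₂ ε (τ : ℂ) := by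
  -- powers of `δ₀`
  have hpow : ∀ (n : ℕ) (σ : ℍ),
      bandAngle ξ₁ ξ₂ ε (((((δ₀ ^ n : Gamma0 N)) : SL(2, ℤ)) • σ : ℍ) : ℂ) = bandAngle ξ₁ ξ₂ ε (σ : ℂ) := by
    intro n
    induction n with
    | zero => intro σ; simp
    | succ n ih =>
      intro σ
      rw [pow_succ, Subgroup.coe_mul, mul_smul, ih, bandAngle_smul_self hξ hκ hw]
  have hzpow : ∀ (n : ℤ) (σ : ℍ),
      bandAngle ξ₁ ξ₂ ε (((((δ₀ ^ n : Gamma0 N)) : SL(2, ℤ)) • σ : ℍ) : ℂ) = bandAngle ξ₁ ξ₂ ε (σ : ℂ) := by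
    intro n σ
    rcases Int.eq_nat_or_neg n with ⟨m, rfl | rfl⟩
    · exact_mod_cast hpow m σ
    · -- `B₀(δ₀^{-m} σ) = B₀(δ₀^m δ₀^{-m} σ) = B₀(σ)`
      have h := hpow m (((δ₀ ^ (-(m : ℤ)) : Gamma0 N) : SL(2, ℤ)) • σ)
      rw [← mul_smul, ← Subgroup.coe_mul, ← zpow_natCast, ← zpow_add, add_neg_cancel, zpow_zero,
        Subgroup.coe_one, one_smul] at h
      exact h.symm
  obtain ⟨n, rfl | rfl⟩ := ha
  · exact hzpow n τ
  · rw [Subgroup.coe_mul, mul_smul, coe_negOne, ModularGroup.SL_neg_smul, one_smul]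
    exact hzpow n τ

/-- **The coset term does not depend on the representative**: `T_τ(⟦g⟧) = B₀(g⁻¹τ)`. [folklore] -/
theorem cosetTerm_mk (hξ : ξ₂ < ξ₁) (hκ : 0 < κ)
    (hw : ∀ z : ℂ, 0 < z.im →
      (moebius (δ₀ : SL(2, ℤ)) z - ξ₁) / (moebius (δ₀ : SL(2, ℤ)) z - ξ₂) = κ * ((z - ξ₁) / (z - ξ₂)))
    (g : Gamma0 N) (τ : ℍ) :
    cosetTerm δ₀ ξ₁ ξ₂ ε τ (g : Gamma0 N ⧸ axisSubgroup δ₀) = bandAngle ξ₁ ξ₂ ε ((((g : SL(2, ℤ)))⁻¹ • τ : ℍ) : ℂ) := by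
  unfold cosetTerm
  set g' : Gamma0 N := Quotient.out (g : Gamma0 N ⧸ axisSubgroup δ₀) with hg'
  -- `g'⁻¹ g ∈ A₀`? we have `g⁻¹ g' ∈ A₀`
  have hmem : g⁻¹ * g' ∈ axisSubgroup δ₀ := by
    rw [← QuotientGroup.eq, hg', QuotientGroup.out_eq']
  -- `g'⁻¹ τ = (g⁻¹ g')⁻¹ • g⁻¹ τ`
  have e : ((g' : SL(2, ℤ)))⁻¹ • τ = (((g⁻¹ * g')⁻¹ : Gamma0 N) : SL(2, ℤ)) • ((g : SL(2, ℤ)))⁻¹ • τ := by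
    rw [← mul_smul]; congr 1; simp [mul_assoc]
  rw [e, bandAngle_smul_of_mem hξ hκ hw ((axisSubgroup δ₀).inv_mem hmem)]

/-- **Reindexing**: `T_{γτ}(c) = T_τ(γ⁻¹ c)`. [folklore] -/
theorem cosetTerm_smul (hξ : ξ₂ < ξ₁) (hκ : 0 < κ)
    (hw : ∀ z : ℂ, 0 < z.im →
      (moebius (δ₀ : SL(2, ℤ)) z - ξ₁) / (moebius (δ₀ : SL(2, ℤ)) z - ξ₂) = κ * ((z - ξ₁) / (z - ξ₂)))
    (γ : Gamma0 N) (τ : ℍ) (c : Gamma0 N ⧸ axisSubgroup δ₀) :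
    cosetTerm δ₀ ξ₁ ξ₂ ε (((γ : SL(2, ℤ))) • τ) c = cosetTerm δ₀ ξ₁ ξ₂ ε τ (γ⁻¹ • c) := by
  induction c using QuotientGroup.induction_on with
  | H g =>
    rw [MulAction.Quotient.smul_mk, cosetTerm_mk hξ hκ hw, cosetTerm_mk hξ hκ hw, ← mul_smul]
    congr 2
    simp [mul_inv_rev]

end Invariance

section Finiteness

variable {ξ₁ ξ₂ κ ε : ℝ} {δ₀ : Gamma0 N}

/-- **Iterating the shift**: `log w(δ₀ⁿ z) = log w(z) + n log κ` for `n ∈ ℤ`. [folklore] -/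
theorem log_w_zpow_smul (hξ : ξ₂ < ξ₁) (hκ : 0 < κ)
    (hw : ∀ z : ℂ, 0 < z.im →
      (moebius (δ₀ : SL(2, ℤ)) z - ξ₁) / (moebius (δ₀ : SL(2, ℤ)) z - ξ₂) = κ * ((z - ξ₁) / (z - ξ₂)))
    (n : ℤ) (σ : ℍ) :
    Complex.log ((((((δ₀ ^ n : Gamma0 N) : SL(2, ℤ)) • σ : ℍ) : ℂ) - ξ₁) /
        (((((δ₀ ^ n : Gamma0 N) : SL(2, ℤ)) • σ : ℍ) : ℂ) - ξ₂)) =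
      Complex.log (((σ : ℂ) - ξ₁) / ((σ : ℂ) - ξ₂)) + n * Real.log κ := by
  have hnat : ∀ (m : ℕ) (σ : ℍ),
      Complex.log ((((((δ₀ ^ m : Gamma0 N) : SL(2, ℤ)) • σ : ℍ) : ℂ) - ξ₁) /
        (((((δ₀ ^ m : Gamma0 N) : SL(2, ℤ)) • σ : ℍ) : ℂ) - ξ₂)) =
      Complex.log (((σ : ℂ) - ξ₁) / ((σ : ℂ) - ξ₂)) + m * Real.log κ := by
    intro m
    induction m with
    | zero => intro σ; simp
    | succ m ih =>
      intro σ
      rw [pow_succ, Subgroup.coe_mul, mul_smul, ih, coe_smul_eq_moebius,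
        HypStrip.log_w_moebius hξ hκ hw σ.im_pos]
      push_cast; ring
  rcases Int.eq_nat_or_neg n with ⟨m, rfl | rfl⟩
  · exact_mod_cast hnat m σ
  · have h := hnat m (((δ₀ ^ (-(m : ℤ)) : Gamma0 N) : SL(2, ℤ)) • σ)
    rw [← mul_smul, ← Subgroup.coe_mul, ← zpow_natCast, ← zpow_add, add_neg_cancel, zpow_zero,
      Subgroup.coe_one, one_smul] at h
    rw [h]; push_cast; ring

/-- A continuous `ℂ`-valued map with values in the upper half-plane is continuous as a map to `ℍ`. [folklore] -/
theorem continuousOn_ofComplex_comp {α : Type*} [TopologicalSpace α] {F : α → ℂ} {s : Set α}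
    (hF : ContinuousOn F s) (him : ∀ x ∈ s, 0 < (F x).im) :
    ContinuousOn (fun x ↦ UpperHalfPlane.ofComplex (F x)) s := by
  rw [UpperHalfPlane.isOpenEmbedding_coe.isEmbedding.isInducing.continuousOn_iff]
  refine hF.congr fun x hx ↦ ?_
  simp [UpperHalfPlane.ofComplex_apply_of_im_pos (him x hx)]

/-- The compact **period box** `K₀ = z([0, |ℓ|] × [π/2 - ε, π/2 + ε]) ⊆ ℍ` of the band. [folklore] -/
theorem isCompact_periodBox (hξ : ξ₂ < ξ₁) (hε' : ε < π / 2) (L : ℝ) :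
    IsCompact ((fun ζ : ℂ ↦ UpperHalfPlane.ofComplex ((ξ₂ * Complex.exp ζ - ξ₁) / (Complex.exp ζ - 1))) ''
      ((Icc (0 : ℝ) L) ×ℂ (Icc (π / 2 - ε) (π / 2 + ε)))) := by
  refine (isCompact_Icc.reProdIm isCompact_Icc).image_of_continuousOn ?_
  have hS : ∀ ζ ∈ (Icc (0 : ℝ) L) ×ℂ (Icc (π / 2 - ε) (π / 2 + ε)), 0 < ζ.im ∧ ζ.im < π :=
    fun ζ hζ ↦ ⟨by linarith [hζ.2.1], by linarith [hζ.2.2]⟩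
  have hden : ∀ ζ ∈ (Icc (0 : ℝ) L) ×ℂ (Icc (π / 2 - ε) (π / 2 + ε)), Complex.exp ζ - 1 ≠ 0 :=
    fun ζ hζ ↦ HypStrip.exp_sub_one_ne_zero (hS ζ hζ).1 (hS ζ hζ).2
  have hzI : ContinuousOn (fun ζ : ℂ ↦ (ξ₂ * Complex.exp ζ - ξ₁) / (Complex.exp ζ - 1))
      ((Icc (0 : ℝ) L) ×ℂ (Icc (π / 2 - ε) (π / 2 + ε))) :=
    ((continuousOn_const.mul Complex.continuous_exp.continuousOn).sub continuousOn_const).div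
      (Complex.continuous_exp.continuousOn.sub continuousOn_const) hden
  exact continuousOn_ofComplex_comp hzI fun ζ hζ ↦ HypStrip.im_zInv_pos hξ (hS ζ hζ).1 (hS ζ hζ).2

/-- **Every point of the closed band is an `A₀`-translate of a point of the period box**: if
`arg w(σ) ∈ [π/2 - ε, π/2 + ε]` then `σ = δ₀⁻ⁿ k` with `log w(k) ∈ [0, |ℓ|] × [π/2 - ε, π/2 + ε]`. [folklore] -/
theorem exists_zpow_smul_mem_periodBox (hξ : ξ₂ < ξ₁) (hκ : 0 < κ) (hκ1 : κ ≠ 1)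
    (hw : ∀ z : ℂ, 0 < z.im →
      (moebius (δ₀ : SL(2, ℤ)) z - ξ₁) / (moebius (δ₀ : SL(2, ℤ)) z - ξ₂) = κ * ((z - ξ₁) / (z - ξ₂)))
    {σ : ℍ} (hσ : Complex.arg (((σ : ℂ) - ξ₁) / ((σ : ℂ) - ξ₂)) ∈ Icc (π / 2 - ε) (π / 2 + ε)) :
    ∃ n : ℤ, (((δ₀ ^ n : Gamma0 N) : SL(2, ℤ)) • σ : ℍ) ∈
      (fun ζ : ℂ ↦ UpperHalfPlane.ofComplex ((ξ₂ * Complex.exp ζ - ξ₁) / (Complex.exp ζ - 1))) ''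
        ((Icc (0 : ℝ) |Real.log κ|) ×ℂ (Icc (π / 2 - ε) (π / 2 + ε))) := by
  set ℓ : ℝ := Real.log κ with hℓ
  have hℓ0 : ℓ ≠ 0 := fun h ↦ hκ1 (Real.eq_one_of_pos_of_log_eq_zero hκ h)
  have hℓa : 0 < |ℓ| := abs_pos.mpr hℓ0
  set t : ℝ := (Complex.log (((σ : ℂ) - ξ₁) / ((σ : ℂ) - ξ₂))).re with ht
  set m : ℤ := ⌊t / |ℓ|⌋ with hm
  -- `n ℓ = -m |ℓ|`
  obtain ⟨n, hn⟩ : ∃ n : ℤ, (n : ℝ) * ℓ = -(m : ℝ) * |ℓ| := by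
    rcases lt_or_gt_of_ne hℓ0 with h | h
    · exact ⟨m, by rw [abs_of_neg h]; ring⟩
    · exact ⟨-m, by rw [abs_of_pos h]; push_cast; ring⟩
  refine ⟨n, ?_⟩
  set k : ℍ := ((δ₀ ^ n : Gamma0 N) : SL(2, ℤ)) • σ with hk
  have hlogk := log_w_zpow_smul hξ hκ hw n σ
  rw [← hk] at hlogk
  refine ⟨Complex.log (((k : ℂ) - ξ₁) / ((k : ℂ) - ξ₂)), ⟨?_, ?_⟩, ?_⟩
  · -- real part in `[0, |ℓ|]`
    rw [hlogk, Set.mem_preimage, Complex.add_re, ← ht]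
    have hre : ((n : ℂ) * (Real.log κ : ℂ)).re = (n : ℝ) * ℓ := by simp [hℓ]
    rw [hre, hn]
    have h1 : (0 : ℝ) ≤ t / |ℓ| - m := by rw [hm]; linarith [Int.floor_le (t / |ℓ|)]
    have h2 : t / |ℓ| - m < 1 := by rw [hm]; linarith [Int.lt_floor_add_one (t / |ℓ|)]
    have e : t + -(m : ℝ) * |ℓ| = (t / |ℓ| - m) * |ℓ| := by field_simp; ring
    rw [e]
    exact ⟨mul_nonneg h1 hℓa.le, by nlinarith⟩
  · -- imaginary part = the angle, unchanged
    rw [hlogk, Set.mem_preimage, Complex.add_im, Complex.log_im]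
    have him : ((n : ℂ) * (Real.log κ : ℂ)).im = 0 := by simp
    rw [him, add_zero]
    exact hσ
  · simp only
    rw [HypStrip.zInv_log_w hξ k.im_pos, UpperHalfPlane.ofComplex_apply]

/-- **Local finiteness of the translates of the band**: for compact `C ⊆ ℍ` only finitely many
cosets `c = gA₀` have `g⁻¹σ` in the closed band for some `σ ∈ C` (every such `σ` lies in
`g δ₀⁻ⁿ K₀` with `K₀` the compact period box, and `{s ∈ SL(2,ℤ) : sK₀ ∩ C ≠ ∅}` is finite by proper
discontinuity). [folklore] -/
theorem finite_setOf_coset_band (hξ : ξ₂ < ξ₁) (hκ : 0 < κ) (hκ1 : κ ≠ 1)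
    (hw : ∀ z : ℂ, 0 < z.im →
      (moebius (δ₀ : SL(2, ℤ)) z - ξ₁) / (moebius (δ₀ : SL(2, ℤ)) z - ξ₂) = κ * ((z - ξ₁) / (z - ξ₂)))
    (hε' : ε < π / 2) {C : Set ℍ} (hC : IsCompact C) :
    {c : Gamma0 N ⧸ axisSubgroup δ₀ | ∃ g : Gamma0 N, (g : Gamma0 N ⧸ axisSubgroup δ₀) = c ∧
      ∃ σ ∈ C, Complex.arg ((((((g : SL(2, ℤ)))⁻¹ • σ : ℍ) : ℂ) - ξ₁) /
        (((((g : SL(2, ℤ)))⁻¹ • σ : ℍ) : ℂ) - ξ₂)) ∈ Icc (π / 2 - ε) (π / 2 + ε)}.Finite := by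
  set K₀ := (fun ζ : ℂ ↦ UpperHalfPlane.ofComplex ((ξ₂ * Complex.exp ζ - ξ₁) / (Complex.exp ζ - 1))) ''
      ((Icc (0 : ℝ) |Real.log κ|) ×ℂ (Icc (π / 2 - ε) (π / 2 + ε))) with hK₀
  have hK₀c : IsCompact K₀ := isCompact_periodBox hξ hε' _
  have hfin := finite_setOf_smul_image_inter_nonempty hK₀c hC
  -- the finite set of `γ ∈ Γ₀(N)` moving `K₀` into `C`
  have hfin' : ((fun γ : Gamma0 N ↦ (γ : SL(2, ℤ))) ⁻¹'
      {s : SL(2, ℤ) | (((fun x : ℍ ↦ s • x) '' K₀) ∩ C).Nonempty}).Finite :=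
    Set.Finite.preimage Subtype.val_injective.injOn hfin
  refine (hfin'.image (fun γ : Gamma0 N ↦ (γ : Gamma0 N ⧸ axisSubgroup δ₀))).subset ?_
  rintro c ⟨g, rfl, σ, hσC, hσ⟩
  obtain ⟨n, hn⟩ := exists_zpow_smul_mem_periodBox (ε := ε) hξ hκ hκ1 hw hσ
  rw [← hK₀] at hn
  -- `σ = (g δ₀⁻ⁿ) (δ₀ⁿ g⁻¹ σ)` with `δ₀ⁿ g⁻¹ σ ∈ K₀`
  set k : ℍ := ((δ₀ ^ n : Gamma0 N) : SL(2, ℤ)) • ((g : SL(2, ℤ)))⁻¹ • σ with hk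
  have hσk : ((g * δ₀ ^ (-n) : Gamma0 N) : SL(2, ℤ)) • k = σ := by
    have e : ((g * δ₀ ^ (-n) : Gamma0 N) : SL(2, ℤ)) *
        (((δ₀ ^ n : Gamma0 N) : SL(2, ℤ)) * ((g : SL(2, ℤ)))⁻¹) = 1 := by
      rw [Subgroup.coe_mul, zpow_neg, Subgroup.coe_inv]; group
    have hk' : k = (((δ₀ ^ n : Gamma0 N) : SL(2, ℤ)) * ((g : SL(2, ℤ)))⁻¹) • σ := by rw [hk, mul_smul]
    rw [hk', ← mul_smul, e, one_smul]
  have hmem : g * δ₀ ^ (-n) ∈ (fun γ : Gamma0 N ↦ (γ : SL(2, ℤ))) ⁻¹'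
      {s : SL(2, ℤ) | (((fun x : ℍ ↦ s • x) '' K₀) ∩ C).Nonempty} :=
    ⟨σ, ⟨k, hn, hσk⟩, hσC⟩
  refine ⟨g * δ₀ ^ (-n), hmem, ?_⟩
  -- same coset
  rw [QuotientGroup.eq]
  simp only [mul_inv_rev, inv_mul_cancel_right]
  exact (axisSubgroup δ₀).inv_mem ⟨-n, Or.inl rfl⟩

/-- **Dichotomy off the band**: outside the open band `B₀ ∈ {0, 1}`. [folklore] -/
theorem bandAngle_eq_zero_or_one (hε : 0 < ε) {z : ℂ}
    (hz : Complex.arg ((z - ξ₁) / (z - ξ₂)) ∉ Ioo (π / 2 - ε) (π / 2 + ε)) :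
    bandAngle ξ₁ ξ₂ ε z = 0 ∨ bandAngle ξ₁ ξ₂ ε z = 1 := by
  rw [mem_Ioo, not_and_or, not_lt, not_lt] at hz
  rcases hz with h | h
  · exact Or.inl (HypStrip.band_eq_zero hε h)
  · exact Or.inr (HypStrip.band_eq_one hε h)

/-- `B₀` is continuous on the upper half-plane. [folklore] -/
theorem continuousOn_bandAngle (hξ : ξ₂ < ξ₁) : ContinuousOn (bandAngle ξ₁ ξ₂ ε) {z : ℂ | 0 < z.im} := by
  intro z hz
  have hw : ContinuousAt (fun z : ℂ ↦ (z - ξ₁) / (z - ξ₂)) z :=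
    (continuousAt_id.sub continuousAt_const).div (continuousAt_id.sub continuousAt_const)
      (HypStrip.sub_ofReal_ne_zero hz ξ₂)
  have harg : ContinuousAt (fun z : ℂ ↦ Complex.arg ((z - ξ₁) / (z - ξ₂))) z :=
    ContinuousAt.comp_of_eq (Complex.continuousAt_arg (HypStrip.w_mem_slitPlane hξ hz)) hw rfl
  have hb : Continuous fun θ : ℝ ↦ Real.smoothTransition ((θ - (π / 2 - ε)) / (2 * ε)) :=
    Real.smoothTransition.continuous.comp ((continuous_id.sub continuous_const).div_const _)
  exact (ContinuousAt.comp_of_eq hb.continuousAt harg rfl).continuousWithinAt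

/-- The **segment** `t ↦ (1 - t)τ₁ + tτ₂` in `ℍ`. [folklore] -/
theorem segment_im_pos (τ₁ τ₂ : ℍ) {t : ℝ} (ht : t ∈ Icc (0 : ℝ) 1) :
    0 < ((1 - t : ℝ) * (τ₁ : ℂ) + (t : ℝ) * (τ₂ : ℂ)).im := by
  have h1 := τ₁.im_pos
  have h2 := τ₂.im_pos
  simp only [Complex.add_im, Complex.mul_im, Complex.ofReal_re, Complex.ofReal_im, zero_mul, add_zero,
    UpperHalfPlane.coe_im]
  rcases eq_or_lt_of_le ht.1 with h | h
  · subst h; simpa using h1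
  · have : 0 ≤ (1 - t) * τ₁.im := mul_nonneg (by linarith [ht.2]) h1.le
    nlinarith

/-- **Constancy along a path off the band**: if the segment from `τ₁` to `τ₂`, moved by `s`,
avoids the open band, then `B₀(sτ₁) = B₀(sτ₂)` (`B₀ ∘ s` is continuous with values in `{0,1}` on
the segment). [folklore] -/
theorem bandAngle_smul_eq_of_forall (hξ : ξ₂ < ξ₁) (hε : 0 < ε) (s : SL(2, ℤ)) (τ₁ τ₂ : ℍ)
    (h : ∀ t ∈ Icc (0 : ℝ) 1,
      Complex.arg (((((s • UpperHalfPlane.ofComplex ((1 - t : ℝ) * (τ₁ : ℂ) + (t : ℝ) * (τ₂ : ℂ)) : ℍ)) : ℂ) - ξ₁) /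
        ((((s • UpperHalfPlane.ofComplex ((1 - t : ℝ) * (τ₁ : ℂ) + (t : ℝ) * (τ₂ : ℂ)) : ℍ)) : ℂ) - ξ₂)) ∉
        Ioo (π / 2 - ε) (π / 2 + ε)) :
    bandAngle ξ₁ ξ₂ ε (((s • τ₁ : ℍ)) : ℂ) = bandAngle ξ₁ ξ₂ ε (((s • τ₂ : ℍ)) : ℂ) := by
  set F : ℝ → ℝ := fun t ↦ bandAngle ξ₁ ξ₂ ε
    ((((s • UpperHalfPlane.ofComplex ((1 - t : ℝ) * (τ₁ : ℂ) + (t : ℝ) * (τ₂ : ℂ)) : ℍ)) : ℂ)) with hF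
  have hF0 : F 0 = bandAngle ξ₁ ξ₂ ε (((s • τ₁ : ℍ)) : ℂ) := by simp [hF]
  have hF1 : F 1 = bandAngle ξ₁ ξ₂ ε (((s • τ₂ : ℍ)) : ℂ) := by simp [hF]
  rw [← hF0, ← hF1]
  -- `F` is continuous on `[0, 1]`
  have hcont : ContinuousOn F (Icc (0 : ℝ) 1) := by
    have hpath : ContinuousOn (fun t : ℝ ↦ (((s • UpperHalfPlane.ofComplex
        ((1 - t : ℝ) * (τ₁ : ℂ) + (t : ℝ) * (τ₂ : ℂ)) : ℍ)) : ℂ)) (Icc (0 : ℝ) 1) := by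
      intro t ht
      have hline : Continuous fun t : ℝ ↦ ((1 - t : ℝ) : ℂ) * (τ₁ : ℂ) + ((t : ℝ) : ℂ) * (τ₂ : ℂ) := by
        fun_prop
      have e : ∀ t ∈ Icc (0 : ℝ) 1, (((s • UpperHalfPlane.ofComplex
          ((1 - t : ℝ) * (τ₁ : ℂ) + (t : ℝ) * (τ₂ : ℂ)) : ℍ)) : ℂ) =
          moebius s (((1 - t : ℝ) : ℂ) * (τ₁ : ℂ) + ((t : ℝ) : ℂ) * (τ₂ : ℂ)) :=
        fun t ht ↦ coe_smul_ofComplex s (segment_im_pos τ₁ τ₂ ht)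
      refine (ContinuousWithinAt.congr ?_ e (e t ht))
      have hd := (hasDerivAt_moebius s (segment_im_pos τ₁ τ₂ ht)).continuousAt
      exact (ContinuousAt.comp_of_eq hd hline.continuousAt rfl).continuousWithinAt
    refine (continuousOn_bandAngle (ε := ε) hξ).comp hpath fun t ht ↦ ?_
    exact (s • UpperHalfPlane.ofComplex _).im_pos
  have hval : ∀ t ∈ Icc (0 : ℝ) 1, F t = 0 ∨ F t = 1 := fun t ht ↦ bandAngle_eq_zero_or_one hε (h t ht)
  -- a continuous `{0,1}`-valued function on `[0,1]` is constant
  by_contra hne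
  have h01 : (F 0 = 0 ∧ F 1 = 1) ∨ (F 0 = 1 ∧ F 1 = 0) := by
    rcases hval 0 (by simp) with h0 | h0 <;> rcases hval 1 (by simp) with h1 | h1
    · exact absurd (h0.trans h1.symm) hne
    · exact Or.inl ⟨h0, h1⟩
    · exact Or.inr ⟨h0, h1⟩
    · exact absurd (h0.trans h1.symm) hne
  have hhalf : ∃ t ∈ Icc (0 : ℝ) 1, F t = 1 / 2 := by
    rcases h01 with ⟨h0, h1⟩ | ⟨h0, h1⟩
    · have := intermediate_value_Icc zero_le_one hcont
      rw [h0, h1] at this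
      exact this ⟨by norm_num, by norm_num⟩
    · have := intermediate_value_Icc' zero_le_one hcont
      rw [h0, h1] at this
      exact this ⟨by norm_num, by norm_num⟩
  obtain ⟨t, ht, hFt⟩ := hhalf
  rcases hval t ht with h0 | h0 <;> rw [h0] at hFt <;> norm_num at hFt

/-- **The sum defining `U` is finite**: only finitely many cosets `c` have `T_{τ₁}(c) ≠ T_{τ₂}(c)`. [folklore] -/
theorem finite_support_cosetTerm_sub (hξ : ξ₂ < ξ₁) (hκ : 0 < κ) (hκ1 : κ ≠ 1)
    (hw : ∀ z : ℂ, 0 < z.im →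
      (moebius (δ₀ : SL(2, ℤ)) z - ξ₁) / (moebius (δ₀ : SL(2, ℤ)) z - ξ₂) = κ * ((z - ξ₁) / (z - ξ₂)))
    (hε : 0 < ε) (hε' : ε < π / 2) (τ₁ τ₂ : ℍ) :
    (Function.support fun c ↦ cosetTerm δ₀ ξ₁ ξ₂ ε τ₁ c - cosetTerm δ₀ ξ₁ ξ₂ ε τ₂ c).Finite := by
  -- the segment from `τ₁` to `τ₂` is compact
  set C : Set ℍ := (fun t : ℝ ↦ UpperHalfPlane.ofComplex ((1 - t : ℝ) * (τ₁ : ℂ) + (t : ℝ) * (τ₂ : ℂ))) ''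
    Icc (0 : ℝ) 1 with hC
  have hCc : IsCompact C := by
    refine isCompact_Icc.image_of_continuousOn ?_
    have hline : Continuous fun t : ℝ ↦ ((1 - t : ℝ) : ℂ) * (τ₁ : ℂ) + ((t : ℝ) : ℂ) * (τ₂ : ℂ) := by
      fun_prop
    exact continuousOn_ofComplex_comp hline.continuousOn fun t ht ↦ segment_im_pos τ₁ τ₂ ht
  refine (finite_setOf_coset_band (ε := ε) hξ hκ hκ1 hw hε' hCc).subset ?_
  intro c hc
  induction c using QuotientGroup.induction_on with
  | H g =>
    refine ⟨g, rfl, ?_⟩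
    rw [Function.mem_support, cosetTerm_mk hξ hκ hw, cosetTerm_mk hξ hκ hw, sub_ne_zero] at hc
    by_contra hall
    push Not at hall
    apply hc
    refine bandAngle_smul_eq_of_forall hξ hε _ τ₁ τ₂ fun t ht hmem ↦ ?_
    exact hall _ ⟨t, ht, rfl⟩ (Ioo_subset_Icc_self hmem)

end Finiteness

section Periods

variable {ξ₁ ξ₂ κ ε : ℝ} {δ₀ : Gamma0 N}
variable (hξ : ξ₂ < ξ₁) (hκ : 0 < κ) (hκ1 : κ ≠ 1)
  (hw : ∀ z : ℂ, 0 < z.im →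
    (moebius (δ₀ : SL(2, ℤ)) z - ξ₁) / (moebius (δ₀ : SL(2, ℤ)) z - ξ₂) = κ * ((z - ξ₁) / (z - ξ₂)))
  (hε : 0 < ε) (hε' : ε < π / 2)
include hξ hκ hκ1 hw hε hε'

/-- **Change of base point**: `U_{τ₃}(τ₁) = U_{τ₂}(τ₁) + U_{τ₃}(τ₂)`. [folklore] -/
theorem dualPotential_add (τ₁ τ₂ τ₃ : ℍ) :
    dualPotential δ₀ ξ₁ ξ₂ ε τ₂ τ₁ + dualPotential δ₀ ξ₁ ξ₂ ε τ₃ τ₂ = dualPotential δ₀ ξ₁ ξ₂ ε τ₃ τ₁ := by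
  unfold dualPotential
  rw [← finsum_add_distrib (finite_support_cosetTerm_sub hξ hκ hκ1 hw hε hε' τ₁ τ₂)
    (finite_support_cosetTerm_sub hξ hκ hκ1 hw hε hε' τ₂ τ₃)]
  exact finsum_congr fun c ↦ by ring

omit hξ hκ hκ1 hw hε hε' in
/-- `U_τ(τ) = 0`. [folklore] -/
theorem dualPotential_self (τ : ℍ) : dualPotential δ₀ ξ₁ ξ₂ ε τ τ = 0 := by
  simp [dualPotential]

/-- **Quasi-periodicity**: `U(γτ) = U(τ) + p(γ)` for `γ ∈ Γ₀(N)` (reindex the sum over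
`Γ₀(N)/A₀` by `c ↦ γ⁻¹c`). [cite: FarkasKra1992, III.1.1 (the periods of a closed form)] -/
theorem dualPotential_smul (τ₀ : ℍ) (γ : Gamma0 N) (τ : ℍ) :
    dualPotential δ₀ ξ₁ ξ₂ ε τ₀ (((γ : SL(2, ℤ))) • τ) =
      dualPotential δ₀ ξ₁ ξ₂ ε τ₀ τ + dualPeriod δ₀ ξ₁ ξ₂ ε τ₀ γ := by
  rw [dualPeriod, ← dualPotential_add hξ hκ hκ1 hw hε hε' _ (((γ : SL(2, ℤ))) • τ₀) τ₀]
  congr 1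
  -- `U_{γτ₀}(γτ) = U_{τ₀}(τ)` by reindexing
  unfold dualPotential
  simp_rw [cosetTerm_smul hξ hκ hw]
  exact finsum_comp_equiv (MulAction.toPerm (γ⁻¹ : Gamma0 N))
    (f := fun c ↦ cosetTerm δ₀ ξ₁ ξ₂ ε τ c - cosetTerm δ₀ ξ₁ ξ₂ ε τ₀ c)

/-- **The period does not depend on the base point**: `p(γ) = ∑_c (T_{γτ}(c) - T_τ(c))` for every `τ`. [folklore] -/
theorem dualPeriod_eq (τ₀ : ℍ) (γ : Gamma0 N) (τ : ℍ) :
    dualPeriod δ₀ ξ₁ ξ₂ ε τ₀ γ =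
      ∑ᶠ c, (cosetTerm δ₀ ξ₁ ξ₂ ε (((γ : SL(2, ℤ))) • τ) c - cosetTerm δ₀ ξ₁ ξ₂ ε τ c) := by
  have h := dualPotential_smul hξ hκ hκ1 hw hε hε' τ₀ γ τ
  have h2 := dualPotential_add hξ hκ hκ1 hw hε hε' (((γ : SL(2, ℤ))) • τ) τ τ₀
  change dualPotential δ₀ ξ₁ ξ₂ ε τ₀ _ = _ at h
  have : dualPotential δ₀ ξ₁ ξ₂ ε τ (((γ : SL(2, ℤ))) • τ) = dualPeriod δ₀ ξ₁ ξ₂ ε τ₀ γ := by linarith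
  rw [← this]; rfl

/-- **The periods are additive**: `p(γγ') = p(γ) + p(γ')`. [folklore] -/
theorem dualPeriod_mul (τ₀ : ℍ) (γ γ' : Gamma0 N) :
    dualPeriod δ₀ ξ₁ ξ₂ ε τ₀ (γ * γ') = dualPeriod δ₀ ξ₁ ξ₂ ε τ₀ γ + dualPeriod δ₀ ξ₁ ξ₂ ε τ₀ γ' := by
  have h := dualPotential_smul hξ hκ hκ1 hw hε hε' τ₀ γ (((γ' : SL(2, ℤ))) • τ₀)
  rw [← mul_smul, ← Subgroup.coe_mul] at h
  rw [dualPeriod, h, add_comm]; rfl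

omit hξ hκ hκ1 hw hε hε' in
/-- **Height bound for the translates of the band.** There is `Y₀` such that every
`SL(2, ℤ)`-translate of a point of the closed band has imaginary part `≤ Y₀`: the band is
`A₀ · K₀` with `K₀` compact, and `im(sk) ≤ max(im k, 1/im k)` for `s ∈ SL(2, ℤ)`. [folklore] -/
theorem exists_height_bound (hξ : ξ₂ < ξ₁) (hκ : 0 < κ) (hκ1 : κ ≠ 1)
    (hw : ∀ z : ℂ, 0 < z.im →
      (moebius (δ₀ : SL(2, ℤ)) z - ξ₁) / (moebius (δ₀ : SL(2, ℤ)) z - ξ₂) = κ * ((z - ξ₁) / (z - ξ₂)))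
    (hε' : ε < π / 2) :
    ∃ Y₀ : ℝ, 0 < Y₀ ∧ ∀ (s : SL(2, ℤ)) (σ : ℍ),
      Complex.arg (((σ : ℂ) - ξ₁) / ((σ : ℂ) - ξ₂)) ∈ Icc (π / 2 - ε) (π / 2 + ε) → (s • σ).im ≤ Y₀ := by
  set K₀ := (fun ζ : ℂ ↦ UpperHalfPlane.ofComplex ((ξ₂ * Complex.exp ζ - ξ₁) / (Complex.exp ζ - 1))) ''
      ((Icc (0 : ℝ) |Real.log κ|) ×ℂ (Icc (π / 2 - ε) (π / 2 + ε))) with hK₀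
  have hK₀c : IsCompact K₀ := isCompact_periodBox hξ hε' _
  -- bounds for `im` on `K₀`
  obtain ⟨Y₁, hY₁⟩ := (hK₀c.image UpperHalfPlane.continuous_im).isBounded.bddAbove
  have hlow : ∃ y₁ : ℝ, 0 < y₁ ∧ ∀ k ∈ K₀, y₁ ≤ k.im := by
    by_cases hne : K₀.Nonempty
    · obtain ⟨k₀, hk₀, hmin⟩ := hK₀c.exists_isMinOn hne UpperHalfPlane.continuous_im.continuousOn
      exact ⟨k₀.im, k₀.im_pos, fun k hk ↦ hmin hk⟩
    · exact ⟨1, one_pos, fun k hk ↦ absurd ⟨k, hk⟩ hne⟩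
  obtain ⟨y₁, hy₁, hy₁K⟩ := hlow
  -- the elementary bound `im(s k) ≤ max(im k, 1/im k)`
  have key : ∀ (s : SL(2, ℤ)) (k : ℍ), (s • k).im ≤ max k.im (1 / k.im) := by
    intro s k
    rw [ModularGroup.im_smul_eq_div_normSq, ModularGroup.denom_apply]
    have hk := k.im_pos
    have hdet : (s 0 0 : ℤ) * (s 1 1 : ℤ) - (s 0 1 : ℤ) * (s 1 0 : ℤ) = 1 := by
      have h := Matrix.SpecialLinearGroup.det_coe s
      rwa [Matrix.det_fin_two] at h
    have hre : (((s 1 0 : ℤ) : ℂ) * (k : ℂ) + ((s 1 1 : ℤ) : ℂ)).re = (s 1 0 : ℤ) * k.re + (s 1 1 : ℤ) := by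
      simp
    have him : (((s 1 0 : ℤ) : ℂ) * (k : ℂ) + ((s 1 1 : ℤ) : ℂ)).im = (s 1 0 : ℤ) * k.im := by
      simp
    have hn : Complex.normSq (((s 1 0 : ℤ) : ℂ) * (k : ℂ) + ((s 1 1 : ℤ) : ℂ)) =
        ((s 1 0 : ℤ) * k.re + (s 1 1 : ℤ)) ^ 2 + ((s 1 0 : ℤ) * k.im) ^ 2 := by
      rw [Complex.normSq_apply, hre, him]; ring
    by_cases hc : (s 1 0 : ℤ) = 0
    · -- `c = 0`: `d = ±1`, `im` unchanged
      have had : (s 0 0 : ℤ) * (s 1 1 : ℤ) = 1 := by rw [hc, mul_zero, sub_zero] at hdet; exact hdet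
      have hd1 : ((s 1 1 : ℤ) : ℝ) ^ 2 = 1 := by
        rcases Int.eq_one_or_neg_one_of_mul_eq_one' had with ⟨-, h⟩ | ⟨-, h⟩ <;> simp [h]
      have hn1 : Complex.normSq (((s 1 0 : ℤ) : ℂ) * (k : ℂ) + ((s 1 1 : ℤ) : ℂ)) = 1 := by
        rw [hn, hc]; push_cast; nlinarith [hd1]
      rw [hn1, div_one]
      exact le_max_left _ _
    · -- `c ≠ 0`: `|ck + d|² ≥ c² (im k)² ≥ (im k)²`
      have hc2 : (1 : ℝ) ≤ ((s 1 0 : ℤ) : ℝ) ^ 2 := by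
        have : (1 : ℤ) ≤ (s 1 0 : ℤ) ^ 2 := by
          rcases lt_or_gt_of_ne hc with h | h <;> nlinarith
        exact_mod_cast this
      have hn2 : k.im ^ 2 ≤ Complex.normSq (((s 1 0 : ℤ) : ℂ) * (k : ℂ) + ((s 1 1 : ℤ) : ℂ)) := by
        rw [hn]
        nlinarith [sq_nonneg ((s 1 0 : ℤ) * k.re + (s 1 1 : ℤ)), mul_pos hk hk]
      refine le_trans ?_ (le_max_right _ _)
      rw [div_le_div_iff₀ (lt_of_lt_of_le (pow_pos hk 2) hn2) hk, one_mul]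
      nlinarith
  refine ⟨max Y₁ (1 / y₁) + 1, by positivity, fun s σ hσ ↦ ?_⟩
  obtain ⟨n, hn⟩ := exists_zpow_smul_mem_periodBox (ε := ε) hξ hκ hκ1 hw hσ
  rw [← hK₀] at hn
  set k : ℍ := ((δ₀ ^ n : Gamma0 N) : SL(2, ℤ)) • σ with hk
  have hσk : σ = (((δ₀ ^ n : Gamma0 N) : SL(2, ℤ)))⁻¹ • k := by rw [hk, inv_smul_smul]
  rw [hσk, ← mul_smul]
  refine (key _ k).trans ?_
  have h1 : k.im ≤ Y₁ := hY₁ ⟨k, hn, rfl⟩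
  have h2 : 1 / k.im ≤ 1 / y₁ := one_div_le_one_div_of_le hy₁ (hy₁K k hn)
  have : max k.im (1 / k.im) ≤ max Y₁ (1 / y₁) := max_le_max h1 h2
  linarith

omit hκ1 hε' in
/-- **Off the translates of the band the coset terms are `0` or `1`**: if `im τ > Y₀` then
`T_τ(c) ∈ {0, 1}` for every coset `c`. [folklore] -/
theorem cosetTerm_eq_zero_or_one_of_height {Y₀ : ℝ}
    (hY : ∀ (s : SL(2, ℤ)) (σ : ℍ),
      Complex.arg (((σ : ℂ) - ξ₁) / ((σ : ℂ) - ξ₂)) ∈ Icc (π / 2 - ε) (π / 2 + ε) → (s • σ).im ≤ Y₀)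
    {τ : ℍ} (hτ : Y₀ < τ.im) (c : Gamma0 N ⧸ axisSubgroup δ₀) :
    cosetTerm δ₀ ξ₁ ξ₂ ε τ c = 0 ∨ cosetTerm δ₀ ξ₁ ξ₂ ε τ c = 1 := by
  induction c using QuotientGroup.induction_on with
  | H g =>
    rw [cosetTerm_mk hξ hκ hw]
    refine bandAngle_eq_zero_or_one hε fun hmem ↦ ?_
    have h := hY (g : SL(2, ℤ)) (((g : SL(2, ℤ)))⁻¹ • τ) (Ioo_subset_Icc_self hmem)
    rw [smul_inv_smul] at h
    linarith

/-- **The periods are integers**: `p(γ) ∈ ℤ` (evaluate `p(γ) = ∑_c (T_{γτ}(c) - T_τ(c))` at a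
point `τ` above all translates of the band, where every term is `0` or `±1`). This is the
integrality of the periods of the dual form of a closed curve (Farkas–Kra III.1.1: its period over
`b` is the intersection number `b · c`). [cite: FarkasKra1992, II.3.3 and III.1.1] -/
theorem exists_int_dualPeriod_eq (τ₀ : ℍ) (γ : Gamma0 N) :
    ∃ m : ℤ, dualPeriod δ₀ ξ₁ ξ₂ ε τ₀ γ = m := by
  obtain ⟨Y₀, hY₀, hY⟩ := exists_height_bound (ε := ε) hξ hκ hκ1 hw hε'
  -- a point above all translates of the band
  set τ : ℍ := ⟨((Y₀ + 1 : ℝ) : ℂ) * I, by simp; linarith⟩ with hτdef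
  have hτ : Y₀ < τ.im := by
    show Y₀ < (((Y₀ + 1 : ℝ) : ℂ) * I).im
    simp
  have h01 := fun c ↦ cosetTerm_eq_zero_or_one_of_height (δ₀ := δ₀) hξ hκ hw hε hY hτ c
  have hfin := finite_support_cosetTerm_sub hξ hκ hκ1 hw hε hε' (((γ : SL(2, ℤ))) • τ) τ
  rw [dualPeriod_eq hξ hκ hκ1 hw hε hε' τ₀ γ τ]
  -- each term is an integer
  have hterm : ∀ c, ∃ m : ℤ,
      cosetTerm δ₀ ξ₁ ξ₂ ε (((γ : SL(2, ℤ))) • τ) c - cosetTerm δ₀ ξ₁ ξ₂ ε τ c = m := by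
    intro c
    rw [cosetTerm_smul hξ hκ hw]
    rcases h01 (γ⁻¹ • c) with h | h <;> rcases h01 c with h' | h' <;> rw [h, h']
    · exact ⟨0, by simp⟩
    · exact ⟨-1, by simp⟩
    · exact ⟨1, by simp⟩
    · exact ⟨0, by simp⟩
  choose G hG using hterm
  have hfun : (fun c ↦ cosetTerm δ₀ ξ₁ ξ₂ ε (((γ : SL(2, ℤ))) • τ) c - cosetTerm δ₀ ξ₁ ξ₂ ε τ c) =
      fun c ↦ ((G c : ℤ) : ℝ) := funext hG
  rw [hfun] at hfin ⊢
  have hfinG : (Function.support G).Finite := by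
    refine hfin.subset fun c hc ↦ ?_
    rw [Function.mem_support] at hc ⊢
    exact_mod_cast hc
  refine ⟨∑ᶠ c, G c, ?_⟩
  have := (Int.castAddHom ℝ).map_finsum (f := G) hfinG
  simpa using this.symm

/-- **`U` is constant on horoballs above the band**: if `Y₀` bounds the height of all translates
of the band, then for every `s ∈ SL(2, ℤ)` the potential `U` is constant on the horoball
`s · {im > Y₀}` at the cusp `s∞` (each `B₀ ∘ g⁻¹` is constant along `s ·` the segment joining
`s⁻¹τ` to `s⁻¹τ'`, which avoids the band). In particular `U` is constant near every cusp. [folklore] -/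
theorem dualPotential_eq_of_height {Y₀ : ℝ}
    (hY : ∀ (s : SL(2, ℤ)) (σ : ℍ),
      Complex.arg (((σ : ℂ) - ξ₁) / ((σ : ℂ) - ξ₂)) ∈ Icc (π / 2 - ε) (π / 2 + ε) → (s • σ).im ≤ Y₀)
    (τ₀ : ℍ) (s : SL(2, ℤ)) {τ τ' : ℍ} (hτ : Y₀ < (s⁻¹ • τ).im) (hτ' : Y₀ < (s⁻¹ • τ').im) :
    dualPotential δ₀ ξ₁ ξ₂ ε τ₀ τ = dualPotential δ₀ ξ₁ ξ₂ ε τ₀ τ' := by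
  rw [← dualPotential_add hξ hκ hκ1 hw hε hε' τ τ' τ₀, add_eq_right]
  unfold dualPotential
  refine finsum_eq_zero_of_forall_eq_zero fun c ↦ ?_
  induction c using QuotientGroup.induction_on with
  | H g =>
    rw [cosetTerm_mk hξ hκ hw, cosetTerm_mk hξ hκ hw, sub_eq_zero]
    -- write `τ = s τ₁`, `τ' = s τ₂` and move the segment `[τ₁, τ₂]` by `g⁻¹ s`
    have e1 : ((g : SL(2, ℤ)))⁻¹ • τ = (((g : SL(2, ℤ)))⁻¹ * s) • (s⁻¹ • τ) := by
      rw [mul_smul, smul_inv_smul]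
    have e2 : ((g : SL(2, ℤ)))⁻¹ • τ' = (((g : SL(2, ℤ)))⁻¹ * s) • (s⁻¹ • τ') := by
      rw [mul_smul, smul_inv_smul]
    rw [e1, e2]
    refine bandAngle_smul_eq_of_forall hξ hε _ _ _ fun t ht hmem ↦ ?_
    -- the segment point has height `> Y₀` but is `(s⁻¹ g) ·` a band point
    set σt : ℍ := UpperHalfPlane.ofComplex ((1 - t : ℝ) * ((s⁻¹ • τ : ℍ) : ℂ) + (t : ℝ) * ((s⁻¹ • τ' : ℍ) : ℂ))
      with hσt
    have hhigh : Y₀ < σt.im := by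
      rw [hσt, ← UpperHalfPlane.coe_im, UpperHalfPlane.ofComplex_apply_of_im_pos (segment_im_pos _ _ ht)]
      simp only [Complex.add_im, Complex.mul_im, Complex.ofReal_re, Complex.ofReal_im, zero_mul, add_zero,
        UpperHalfPlane.coe_im]
      have hpos : 0 < (1 - t) * ((s⁻¹ • τ).im - Y₀) + t * ((s⁻¹ • τ').im - Y₀) := by
        rcases eq_or_lt_of_le ht.2 with h | hlt
        · rw [h, sub_self, zero_mul, zero_add, one_mul]; linarith
        · nlinarith [mul_pos (sub_pos.mpr hlt) (sub_pos.mpr hτ), mul_nonneg ht.1 (sub_pos.mpr hτ').le]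
      nlinarith
    have hle := hY ((((g : SL(2, ℤ)))⁻¹ * s)⁻¹) _ (Ioo_subset_Icc_self hmem)
    rw [inv_smul_smul] at hle
    linarith

end Periods

/-! ### Smoothness of `U` and its derivative -/

/-- The logarithmic derivative `ζ'(σ) = 1/(σ - ξ₁) - 1/(σ - ξ₂)` of `w` composed with the derivative
`s'(z) = (cz + d)⁻²` of `s`: the complex derivative of `ζ ∘ s` at `z`. [folklore] -/
def stripDeriv (ξ₁ ξ₂ : ℝ) (s : SL(2, ℤ)) (z : ℂ) : ℂ :=
  (1 / (moebius s z - ξ₁) - 1 / (moebius s z - ξ₂)) * (1 / (((s 1 0 : ℤ) : ℂ) * z + ((s 1 1 : ℤ) : ℂ)) ^ 2)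

/-- **The derivative piece** of `z ↦ B₀(sz)`: the real-linear form
`h ↦ b'(arg w(sz)) · im(ζ'(sz) s'(z) h)`, written in the basis `re, im`. [folklore] -/
def bandPiece (ξ₁ ξ₂ ε : ℝ) (s : SL(2, ℤ)) (z : ℂ) : ℂ →L[ℝ] ℝ :=
  (deriv (fun θ : ℝ ↦ Real.smoothTransition ((θ - (π / 2 - ε)) / (2 * ε)))
      (Complex.arg ((moebius s z - ξ₁) / (moebius s z - ξ₂))) * (stripDeriv ξ₁ ξ₂ s z).im) • Complex.reCLM +
  (deriv (fun θ : ℝ ↦ Real.smoothTransition ((θ - (π / 2 - ε)) / (2 * ε)))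
      (Complex.arg ((moebius s z - ξ₁) / (moebius s z - ξ₂))) * (stripDeriv ξ₁ ξ₂ s z).re) • Complex.imCLM

/-- **The derivative of `U`**: `U'(z) = ∑_c (B₀ ∘ g_c⁻¹)'(z)`, a finite sum near each point
(`hasFDerivAt_dualPotential`). [folklore] -/
def dualPotentialDeriv (δ₀ : Gamma0 N) (ξ₁ ξ₂ ε : ℝ) (z : ℂ) : ℂ →L[ℝ] ℝ :=
  ∑ᶠ c : Gamma0 N ⧸ axisSubgroup δ₀, bandPiece ξ₁ ξ₂ ε ((((Quotient.out c : Gamma0 N)) : SL(2, ℤ)))⁻¹ z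

section Deriv

variable {ξ₁ ξ₂ κ ε : ℝ} {δ₀ : Gamma0 N}

/-- The band piece applied to a vector: `b'(θ) im(ζ'(sz) s'(z) h)`. [folklore] -/
@[simp] theorem bandPiece_apply (s : SL(2, ℤ)) (z h : ℂ) :
    bandPiece ξ₁ ξ₂ ε s z h =
      deriv (fun θ : ℝ ↦ Real.smoothTransition ((θ - (π / 2 - ε)) / (2 * ε)))
        (Complex.arg ((moebius s z - ξ₁) / (moebius s z - ξ₂))) * (stripDeriv ξ₁ ξ₂ s z * h).im := by
  simp only [bandPiece, _root_.add_apply, FunLike.coe_smul, Pi.smul_apply,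
    Complex.reCLM_apply, Complex.imCLM_apply, smul_eq_mul, Complex.mul_im]
  ring

/-- **The `∂/∂z̄`-part of the derivative piece**: `P(1) + i P(i) = i b'(θ) \overline{ζ'(sz) s'(z)}`. [folklore] -/
theorem bandPiece_dbar (s : SL(2, ℤ)) (z : ℂ) :
    ((bandPiece ξ₁ ξ₂ ε s z 1 : ℝ) : ℂ) + I * ((bandPiece ξ₁ ξ₂ ε s z I : ℝ) : ℂ) =
      I * ((deriv (fun θ : ℝ ↦ Real.smoothTransition ((θ - (π / 2 - ε)) / (2 * ε)))
        (Complex.arg ((moebius s z - ξ₁) / (moebius s z - ξ₂))) : ℝ) : ℂ) * conj (stripDeriv ξ₁ ξ₂ s z) := by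
  apply Complex.ext <;> simp [bandPiece_apply]

/-- **`z ↦ B₀(sz)` is differentiable** on the upper half-plane with derivative the band piece
(chain rule: `b ∘ im ∘ log ∘ w ∘ s`). [folklore] -/
theorem hasFDerivAt_bandAngle_moebius (hξ : ξ₂ < ξ₁) (s : SL(2, ℤ)) {z : ℂ} (hz : 0 < z.im) :
    HasFDerivAt (fun z : ℂ ↦ bandAngle ξ₁ ξ₂ ε (moebius s z)) (bandPiece ξ₁ ξ₂ ε s z) z := by
  have hsz := moebius_im_pos s hz
  -- the holomorphic part `G = log ∘ w ∘ s`
  have hG : HasDerivAt (fun z : ℂ ↦ Complex.log ((moebius s z - ξ₁) / (moebius s z - ξ₂)))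
      (stripDeriv ξ₁ ξ₂ s z) z :=
    (HypStrip.hasDerivAt_log_w hξ hsz).comp z (hasDerivAt_moebius s hz)
  have hθ : HasFDerivAt (fun z : ℂ ↦ Complex.arg ((moebius s z - ξ₁) / (moebius s z - ξ₂)))
      (Complex.imCLM.comp ((ContinuousLinearMap.smulRight (1 : ℂ →L[ℂ] ℂ) (stripDeriv ξ₁ ξ₂ s z)).restrictScalars ℝ)) z := by
    have h1 := (hG.hasFDerivAt.restrictScalars ℝ)
    have h2 := Complex.imCLM.hasFDerivAt.comp z h1
    refine h2.congr_of_eventuallyEq ?_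
    filter_upwards [(Complex.continuous_im.isOpen_preimage _ isOpen_Ioi).mem_nhds hz] with z' hz'
    simp only [Function.comp_apply, Complex.imCLM_apply, Complex.log_im]
  have hb : HasDerivAt (fun θ : ℝ ↦ Real.smoothTransition ((θ - (π / 2 - ε)) / (2 * ε)))
      (deriv (fun θ : ℝ ↦ Real.smoothTransition ((θ - (π / 2 - ε)) / (2 * ε)))
        (Complex.arg ((moebius s z - ξ₁) / (moebius s z - ξ₂)))) (Complex.arg ((moebius s z - ξ₁) / (moebius s z - ξ₂))) :=
    ((HypStrip.contDiff_band (ε := ε)).differentiable one_ne_zero).differentiableAt.hasDerivAt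
  have h := hb.comp_hasFDerivAt z hθ
  refine HasFDerivAt.congr_fderiv h ?_
  ext h'
  simp only [FunLike.coe_smul, Pi.smul_apply, ContinuousLinearMap.coe_comp,
    Function.comp_apply, ContinuousLinearMap.coe_restrictScalars', ContinuousLinearMap.smulRight_apply,
    one_apply_eq_self, Complex.imCLM_apply, smul_eq_mul, bandPiece_apply]
  rw [mul_comm h' (stripDeriv ξ₁ ξ₂ s z)]

/-- The derivative piece is continuous on the upper half-plane. [folklore] -/
theorem continuousOn_bandPiece (hξ : ξ₂ < ξ₁) (s : SL(2, ℤ)) :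
    ContinuousOn (bandPiece ξ₁ ξ₂ ε s) {z : ℂ | 0 < z.im} := by
  have hm : ContinuousOn (moebius s) {z : ℂ | 0 < z.im} := fun z hz ↦
    (hasDerivAt_moebius s hz).continuousAt.continuousWithinAt
  have hmaps : MapsTo (moebius s) {z : ℂ | 0 < z.im} {z : ℂ | 0 < z.im} := fun z hz ↦ moebius_im_pos s hz
  have hθ : ContinuousOn (fun z : ℂ ↦ Complex.arg ((moebius s z - ξ₁) / (moebius s z - ξ₂))) {z : ℂ | 0 < z.im} := by
    have harg : ContinuousOn (fun σ : ℂ ↦ Complex.arg ((σ - ξ₁) / (σ - ξ₂))) {z : ℂ | 0 < z.im} := by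
      intro σ hσ
      have hw : ContinuousAt (fun z : ℂ ↦ (z - ξ₁) / (z - ξ₂)) σ :=
        (continuousAt_id.sub continuousAt_const).div (continuousAt_id.sub continuousAt_const)
          (HypStrip.sub_ofReal_ne_zero hσ ξ₂)
      exact (ContinuousAt.comp_of_eq (Complex.continuousAt_arg (HypStrip.w_mem_slitPlane hξ hσ)) hw rfl).continuousWithinAt
    exact harg.comp hm hmaps
  have hb : Continuous (deriv (fun θ : ℝ ↦ Real.smoothTransition ((θ - (π / 2 - ε)) / (2 * ε)))) :=
    (HypStrip.contDiff_band (ε := ε)).continuous_deriv le_rfl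
  have hbθ := hb.comp_continuousOn hθ
  have hD : ContinuousOn (stripDeriv ξ₁ ξ₂ s) {z : ℂ | 0 < z.im} := by
    unfold stripDeriv
    refine ContinuousOn.mul ?_ ?_
    · have h1 : ContinuousOn (fun σ : ℂ ↦ 1 / (σ - ξ₁) - 1 / (σ - ξ₂)) {z : ℂ | 0 < z.im} := by
        intro σ hσ
        exact (((continuousAt_const.div (continuousAt_id.sub continuousAt_const) (HypStrip.sub_ofReal_ne_zero hσ ξ₁))).sub
          ((continuousAt_const.div (continuousAt_id.sub continuousAt_const) (HypStrip.sub_ofReal_ne_zero hσ ξ₂)))).continuousWithinAt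
      exact h1.comp hm hmaps
    · intro z hz
      exact ((continuousAt_const.div (((continuousAt_const.mul continuousAt_id).add continuousAt_const).pow 2)
        (pow_ne_zero 2 (moebius_denom_ne_zero s hz)))).continuousWithinAt
  unfold bandPiece
  exact ((hbθ.mul (Complex.continuous_im.comp_continuousOn hD)).smul continuousOn_const).add
    ((hbθ.mul (Complex.continuous_re.comp_continuousOn hD)).smul continuousOn_const)

end Deriv

section DerivU

variable {ξ₁ ξ₂ κ ε : ℝ} {δ₀ : Gamma0 N}
variable (hξ : ξ₂ < ξ₁) (hκ : 0 < κ) (hκ1 : κ ≠ 1)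
  (hw : ∀ z : ℂ, 0 < z.im →
    (moebius (δ₀ : SL(2, ℤ)) z - ξ₁) / (moebius (δ₀ : SL(2, ℤ)) z - ξ₂) = κ * ((z - ξ₁) / (z - ξ₂)))
  (hε : 0 < ε) (hε' : ε < π / 2)
include hξ hκ hκ1 hw hε hε'

/-- **Local finiteness**: near every point of `ℍ` only finitely many cosets contribute to `U`:
there are a finite set `E` of cosets and a ball around `z₀` on which `T_z(c) = T_{τ₀}(c)` for all
`c ∉ E`. [folklore] -/
theorem exists_finset_ball (τ₀ : ℍ) {z₀ : ℂ} (hz₀ : 0 < z₀.im) :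
    ∃ (E : Finset (Gamma0 N ⧸ axisSubgroup δ₀)) (r : ℝ), 0 < r ∧ (∀ z ∈ Metric.ball z₀ r, 0 < z.im) ∧
      ∀ z ∈ Metric.ball z₀ r, ∀ c ∉ E,
        cosetTerm δ₀ ξ₁ ξ₂ ε (UpperHalfPlane.ofComplex z) c = cosetTerm δ₀ ξ₁ ξ₂ ε τ₀ c := by
  set r : ℝ := z₀.im / 2 with hr
  have hr0 : 0 < r := by positivity
  have hball : ∀ z ∈ Metric.closedBall z₀ r, r ≤ z.im := by
    intro z hz
    rw [Metric.mem_closedBall] at hz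
    have h := (Complex.abs_im_le_norm (z - z₀)).trans (by simpa [dist_eq_norm] using hz)
    rw [Complex.sub_im, abs_le] at h
    linarith [h.1]
  have hballU : ∀ z ∈ Metric.ball z₀ r, 0 < z.im := fun z hz ↦
    lt_of_lt_of_le hr0 (hball z (Metric.ball_subset_closedBall hz))
  -- the compact set swept by the segments from the closed ball to `τ₀`
  set S : Set ℂ := (fun p : ℂ × ℝ ↦ ((1 - p.2 : ℝ) : ℂ) * p.1 + ((p.2 : ℝ) : ℂ) * (τ₀ : ℂ)) ''
    (Metric.closedBall z₀ r ×ˢ Icc (0 : ℝ) 1) with hS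
  have hSc : IsCompact S :=
    ((isCompact_closedBall z₀ r).prod isCompact_Icc).image (by fun_prop)
  have hSim : ∀ w ∈ S, 0 < w.im := by
    rintro w ⟨⟨z, t⟩, ⟨hz, ht⟩, rfl⟩
    have hz' := hball z hz
    have h0 := τ₀.im_pos
    simp only [Complex.add_im, Complex.mul_im, Complex.ofReal_re, Complex.ofReal_im, zero_mul, add_zero,
      UpperHalfPlane.coe_im]
    have ht' : t ∈ Icc (0 : ℝ) 1 := ht
    rcases eq_or_lt_of_le ht'.2 with h | h
    · rw [h]; simp; exact h0
    · nlinarith [ht'.1, mul_pos (sub_pos.mpr h) (lt_of_lt_of_le hr0 hz')]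
  set C : Set ℍ := (fun w : ℂ ↦ UpperHalfPlane.ofComplex w) '' S with hC
  have hCc : IsCompact C := hSc.image_of_continuousOn (continuousOn_ofComplex_comp continuousOn_id hSim)
  obtain hfin := finite_setOf_coset_band (ε := ε) hξ hκ hκ1 hw hε' hCc
  refine ⟨hfin.toFinset, r, hr0, hballU, fun z hz c hc ↦ ?_⟩
  rw [Set.Finite.mem_toFinset] at hc
  induction c using QuotientGroup.induction_on with
  | H g =>
    rw [cosetTerm_mk hξ hκ hw, cosetTerm_mk hξ hκ hw]
    refine bandAngle_smul_eq_of_forall hξ hε _ _ _ fun t ht hmem ↦ hc ⟨g, rfl, _, ?_, Ioo_subset_Icc_self hmem⟩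
    refine ⟨(1 - t : ℝ) * ((UpperHalfPlane.ofComplex z : ℍ) : ℂ) + (t : ℝ) * (τ₀ : ℂ), ⟨(z, t), ⟨?_, ht⟩, ?_⟩, rfl⟩
    · exact Metric.ball_subset_closedBall hz
    · simp [UpperHalfPlane.ofComplex_apply_of_im_pos (hballU z hz)]

omit hξ hκ hκ1 hw hε hε' in
/-- `T_z(c) = B₀(g_c⁻¹ z)` as a function of `z ∈ ℂ` (through `ofComplex`), `g_c = c.out`. [folklore] -/
theorem cosetTerm_ofComplex (c : Gamma0 N ⧸ axisSubgroup δ₀) {z : ℂ} (hz : 0 < z.im) :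
    cosetTerm δ₀ ξ₁ ξ₂ ε (UpperHalfPlane.ofComplex z) c =
      bandAngle ξ₁ ξ₂ ε (moebius ((((Quotient.out c : Gamma0 N)) : SL(2, ℤ)))⁻¹ z) := by
  rw [cosetTerm, coe_smul_ofComplex _ hz]

omit hκ hκ1 hw hε hε' in
/-- **On the ball of `exists_finset_ball` the derivative pieces outside `E` vanish** (they are
derivatives of functions constant on the ball). [folklore] -/
theorem bandPiece_eq_zero_of_not_mem (τ₀ : ℍ) {E : Finset (Gamma0 N ⧸ axisSubgroup δ₀)} {z₀ : ℂ} {r : ℝ}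
    (hU : ∀ z ∈ Metric.ball z₀ r, 0 < z.im)
    (hE : ∀ z ∈ Metric.ball z₀ r, ∀ c ∉ E,
      cosetTerm δ₀ ξ₁ ξ₂ ε (UpperHalfPlane.ofComplex z) c = cosetTerm δ₀ ξ₁ ξ₂ ε τ₀ c)
    {z : ℂ} (hz : z ∈ Metric.ball z₀ r) {c : Gamma0 N ⧸ axisSubgroup δ₀} (hc : c ∉ E) :
    bandPiece ξ₁ ξ₂ ε ((((Quotient.out c : Gamma0 N)) : SL(2, ℤ)))⁻¹ z = 0 := by
  have h1 : HasFDerivAt (fun z : ℂ ↦ bandAngle ξ₁ ξ₂ ε (moebius ((((Quotient.out c : Gamma0 N)) : SL(2, ℤ)))⁻¹ z))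
      (bandPiece ξ₁ ξ₂ ε ((((Quotient.out c : Gamma0 N)) : SL(2, ℤ)))⁻¹ z) z :=
    hasFDerivAt_bandAngle_moebius hξ _ (hU z hz)
  have h2 : HasFDerivAt (fun z : ℂ ↦ bandAngle ξ₁ ξ₂ ε (moebius ((((Quotient.out c : Gamma0 N)) : SL(2, ℤ)))⁻¹ z))
      (0 : ℂ →L[ℝ] ℝ) z := by
    refine (hasFDerivAt_const (cosetTerm δ₀ ξ₁ ξ₂ ε τ₀ c) z).congr_of_eventuallyEq ?_
    filter_upwards [Metric.isOpen_ball.mem_nhds hz] with z' hz'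
    rw [← cosetTerm_ofComplex c (hU z' hz'), hE z' hz' c hc]
  exact h1.unique h2

omit hκ hκ1 hw hε hε' in
/-- On the ball of `exists_finset_ball`, `U'(z) = ∑_{c ∈ E} (B₀ ∘ g_c⁻¹)'(z)`. [folklore] -/
theorem dualPotentialDeriv_eq_sum (τ₀ : ℍ) {E : Finset (Gamma0 N ⧸ axisSubgroup δ₀)} {z₀ : ℂ} {r : ℝ}
    (hU : ∀ z ∈ Metric.ball z₀ r, 0 < z.im)
    (hE : ∀ z ∈ Metric.ball z₀ r, ∀ c ∉ E,
      cosetTerm δ₀ ξ₁ ξ₂ ε (UpperHalfPlane.ofComplex z) c = cosetTerm δ₀ ξ₁ ξ₂ ε τ₀ c)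
    {z : ℂ} (hz : z ∈ Metric.ball z₀ r) :
    dualPotentialDeriv δ₀ ξ₁ ξ₂ ε z =
      ∑ c ∈ E, bandPiece ξ₁ ξ₂ ε ((((Quotient.out c : Gamma0 N)) : SL(2, ℤ)))⁻¹ z := by
  unfold dualPotentialDeriv
  refine finsum_eq_sum_of_support_subset _ fun c hc ↦ ?_
  rw [Finset.mem_coe]
  by_contra hcE
  exact hc (bandPiece_eq_zero_of_not_mem hξ τ₀ hU hE hz hcE)

/-- **`U` is differentiable** with derivative `U'` (a finite sum near each point). [folklore] -/
theorem hasFDerivAt_dualPotential (τ₀ : ℍ) {z₀ : ℂ} (hz₀ : 0 < z₀.im) :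
    HasFDerivAt (fun z : ℂ ↦ dualPotential δ₀ ξ₁ ξ₂ ε τ₀ (UpperHalfPlane.ofComplex z))
      (dualPotentialDeriv δ₀ ξ₁ ξ₂ ε z₀) z₀ := by
  obtain ⟨E, r, hr, hU, hE⟩ := exists_finset_ball hξ hκ hκ1 hw hε hε' τ₀ hz₀
  have hz₀b : z₀ ∈ Metric.ball z₀ r := Metric.mem_ball_self hr
  rw [dualPotentialDeriv_eq_sum hξ τ₀ hU hE hz₀b]
  -- on the ball `U` is the finite sum over `E`
  have hloc : ∀ z ∈ Metric.ball z₀ r, dualPotential δ₀ ξ₁ ξ₂ ε τ₀ (UpperHalfPlane.ofComplex z) =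
      ∑ c ∈ E, (bandAngle ξ₁ ξ₂ ε (moebius ((((Quotient.out c : Gamma0 N)) : SL(2, ℤ)))⁻¹ z) -
        cosetTerm δ₀ ξ₁ ξ₂ ε τ₀ c) := by
    intro z hz
    unfold dualPotential
    rw [finsum_eq_sum_of_support_subset _ (s := E)]
    · exact Finset.sum_congr rfl fun c _ ↦ by rw [cosetTerm_ofComplex c (hU z hz)]
    · intro c hc
      rw [Finset.mem_coe]
      by_contra hcE
      exact hc (by simp only [hE z hz c hcE, sub_self])
  have hsum : HasFDerivAt (fun z : ℂ ↦ ∑ c ∈ E, (bandAngle ξ₁ ξ₂ ε (moebius ((((Quotient.out c : Gamma0 N)) : SL(2, ℤ)))⁻¹ z) -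
      cosetTerm δ₀ ξ₁ ξ₂ ε τ₀ c))
      (∑ c ∈ E, bandPiece ξ₁ ξ₂ ε ((((Quotient.out c : Gamma0 N)) : SL(2, ℤ)))⁻¹ z₀) z₀ := by
    refine HasFDerivAt.fun_sum fun c _ ↦ ?_
    simpa using (hasFDerivAt_bandAngle_moebius (ε := ε) hξ ((((Quotient.out c : Gamma0 N)) : SL(2, ℤ)))⁻¹ hz₀).sub_const
      (cosetTerm δ₀ ξ₁ ξ₂ ε τ₀ c)
  refine hsum.congr_of_eventuallyEq ?_
  filter_upwards [Metric.isOpen_ball.mem_nhds hz₀b] with z hz using hloc z hz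

/-- **`U'` is continuous** on the upper half-plane. [folklore] -/
theorem continuousOn_dualPotentialDeriv (τ₀ : ℍ) :
    ContinuousOn (dualPotentialDeriv δ₀ ξ₁ ξ₂ ε) {z : ℂ | 0 < z.im} := by
  intro z₀ hz₀
  obtain ⟨E, r, hr, hU, hE⟩ := exists_finset_ball hξ hκ hκ1 hw hε hε' τ₀ hz₀
  have hcont : ContinuousOn (fun z ↦ ∑ c ∈ E, bandPiece ξ₁ ξ₂ ε ((((Quotient.out c : Gamma0 N)) : SL(2, ℤ)))⁻¹ z)
      (Metric.ball z₀ r) :=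
    continuousOn_finsetSum E fun c _ ↦ (continuousOn_bandPiece (ε := ε) hξ _).mono fun z hz ↦ hU z hz
  have hc : ContinuousAt (dualPotentialDeriv δ₀ ξ₁ ξ₂ ε) z₀ := by
    have h := (hcont.congr fun z hz ↦ dualPotentialDeriv_eq_sum hξ τ₀ hU hE hz).continuousAt
      (Metric.isOpen_ball.mem_nhds (Metric.mem_ball_self hr))
    exact h
  exact hc.continuousWithinAt

end DerivU

/-! ### The `Γ₀(N)`-periodisation of the cut-off `∂B₀/∂z̄` is `2 ∂U/∂z̄` -/

section Dbar

variable {ξ₁ ξ₂ κ ε : ℝ} {δ₀ : Gamma0 N}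

/-- `moebius (t t') z = moebius t (moebius t' z)` on the upper half-plane. [folklore] -/
theorem moebius_mul (t t' : SL(2, ℤ)) {z : ℂ} (hz : 0 < z.im) :
    moebius (t * t') z = moebius t (moebius t' z) := by
  rw [← coe_smul_ofComplex _ hz, mul_smul, ← coe_smul_ofComplex _ (moebius_im_pos t' hz),
    ← smul_ofComplex t' hz]

/-- `moebius (-t) = moebius t`. [folklore] -/
theorem moebius_neg (t : SL(2, ℤ)) {z : ℂ} (hz : 0 < z.im) : moebius (-t) z = moebius t z := by
  rw [← coe_smul_ofComplex _ hz, ModularGroup.SL_neg_smul, coe_smul_ofComplex _ hz]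

/-- The strip coordinate composed with `t ∈ SL(2, ℤ)` has complex derivative `stripDeriv t z`. [folklore] -/
theorem hasDerivAt_log_w_moebius (hξ : ξ₂ < ξ₁) (t : SL(2, ℤ)) {z : ℂ} (hz : 0 < z.im) :
    HasDerivAt (fun z : ℂ ↦ Complex.log ((moebius t z - ξ₁) / (moebius t z - ξ₂))) (stripDeriv ξ₁ ξ₂ t z) z :=
  (HypStrip.hasDerivAt_log_w hξ (moebius_im_pos t hz)).comp z (hasDerivAt_moebius t hz)

/-- An element of `A₀` acts as a power of `δ₀`. [folklore] -/
theorem exists_zpow_of_mem {a : Gamma0 N} (ha : a ∈ axisSubgroup δ₀) :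
    ∃ n : ℤ, ∀ {z : ℂ}, 0 < z.im → moebius (a : SL(2, ℤ)) z = moebius ((δ₀ ^ n : Gamma0 N) : SL(2, ℤ)) z := by
  obtain ⟨n, rfl | rfl⟩ := ha
  · exact ⟨n, fun _ ↦ rfl⟩
  · refine ⟨n, fun hz ↦ ?_⟩
    rw [Subgroup.coe_mul, coe_negOne, neg_one_mul, moebius_neg _ hz]

/-- **Shift under `A₀`**: `log w(a t z) = log w(t z) + n ℓ` for `a ∈ A₀` acting as `δ₀ⁿ`. [folklore] -/
theorem log_w_moebius_mul_of_eq (hξ : ξ₂ < ξ₁) (hκ : 0 < κ)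
    (hw : ∀ z : ℂ, 0 < z.im →
      (moebius (δ₀ : SL(2, ℤ)) z - ξ₁) / (moebius (δ₀ : SL(2, ℤ)) z - ξ₂) = κ * ((z - ξ₁) / (z - ξ₂)))
    {a : Gamma0 N} {n : ℤ}
    (hn : ∀ {z : ℂ}, 0 < z.im → moebius (a : SL(2, ℤ)) z = moebius ((δ₀ ^ n : Gamma0 N) : SL(2, ℤ)) z)
    (t : SL(2, ℤ)) {z : ℂ} (hz : 0 < z.im) :
    Complex.log ((moebius ((a : SL(2, ℤ)) * t) z - ξ₁) / (moebius ((a : SL(2, ℤ)) * t) z - ξ₂)) =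
      Complex.log ((moebius t z - ξ₁) / (moebius t z - ξ₂)) + n * Real.log κ := by
  have hz' := moebius_im_pos t hz
  rw [moebius_mul _ _ hz, hn hz', ← coe_smul_ofComplex _ hz']
  have h := log_w_zpow_smul hξ hκ hw n (UpperHalfPlane.ofComplex (moebius t z))
  have e : ((UpperHalfPlane.ofComplex (moebius t z) : ℍ) : ℂ) = moebius t z := by
    rw [UpperHalfPlane.ofComplex_apply_of_im_pos hz']
  rw [e] at h
  exact h

/-- **Invariance of the form `ζ' dz` under `A₀`**: `stripDeriv (a t) z = stripDeriv t z`. [folklore] -/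
theorem stripDeriv_mul_of_eq (hξ : ξ₂ < ξ₁) (hκ : 0 < κ)
    (hw : ∀ z : ℂ, 0 < z.im →
      (moebius (δ₀ : SL(2, ℤ)) z - ξ₁) / (moebius (δ₀ : SL(2, ℤ)) z - ξ₂) = κ * ((z - ξ₁) / (z - ξ₂)))
    {a : Gamma0 N} {n : ℤ}
    (hn : ∀ {z : ℂ}, 0 < z.im → moebius (a : SL(2, ℤ)) z = moebius ((δ₀ ^ n : Gamma0 N) : SL(2, ℤ)) z)
    (t : SL(2, ℤ)) {z : ℂ} (hz : 0 < z.im) :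
    stripDeriv ξ₁ ξ₂ ((a : SL(2, ℤ)) * t) z = stripDeriv ξ₁ ξ₂ t z := by
  have h1 := hasDerivAt_log_w_moebius hξ ((a : SL(2, ℤ)) * t) hz
  have h2 : HasDerivAt (fun z : ℂ ↦ Complex.log ((moebius ((a : SL(2, ℤ)) * t) z - ξ₁) /
      (moebius ((a : SL(2, ℤ)) * t) z - ξ₂))) (stripDeriv ξ₁ ξ₂ t z) z := by
    refine ((hasDerivAt_log_w_moebius hξ t hz).add_const ((n : ℂ) * Real.log κ)).congr_of_eventuallyEq ?_
    filter_upwards [(Complex.continuous_im.isOpen_preimage _ isOpen_Ioi).mem_nhds hz] with z' hz'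
    exact log_w_moebius_mul_of_eq hξ hκ hw hn t hz'
  exact h1.unique h2

/-- **No power of `δ₀` acts trivially**: if `δ₀ᵏ` acts as the identity on `ℍ` then `k = 0`
(`log w` is shifted by `kℓ`, `ℓ ≠ 0`). [folklore] -/
theorem zpow_eq_zero_of_forall (hξ : ξ₂ < ξ₁) (hκ : 0 < κ) (hκ1 : κ ≠ 1)
    (hw : ∀ z : ℂ, 0 < z.im →
      (moebius (δ₀ : SL(2, ℤ)) z - ξ₁) / (moebius (δ₀ : SL(2, ℤ)) z - ξ₂) = κ * ((z - ξ₁) / (z - ξ₂)))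
    {k : ℤ} (hk : ∀ σ : ℍ, ((δ₀ ^ k : Gamma0 N) : SL(2, ℤ)) • σ = σ) : k = 0 := by
  have h := log_w_zpow_smul hξ hκ hw k UpperHalfPlane.I
  rw [hk, left_eq_add, mul_eq_zero] at h
  rcases h with h | h
  · exact_mod_cast h
  · exfalso
    have : Real.log κ = 0 := by exact_mod_cast h
    exact hκ1 (Real.eq_one_of_pos_of_log_eq_zero hκ this)

/-- The exponent of an element of `A₀ = {±δ₀ⁿ}` is well defined. [folklore] -/
theorem zpow_exponent_unique (hξ : ξ₂ < ξ₁) (hκ : 0 < κ) (hκ1 : κ ≠ 1)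
    (hw : ∀ z : ℂ, 0 < z.im →
      (moebius (δ₀ : SL(2, ℤ)) z - ξ₁) / (moebius (δ₀ : SL(2, ℤ)) z - ξ₂) = κ * ((z - ξ₁) / (z - ξ₂)))
    {m n : ℤ} {b b' : Bool}
    (h : (if b then negOne * δ₀ ^ m else δ₀ ^ m) = (if b' then negOne * δ₀ ^ n else δ₀ ^ n)) :
    m = n ∧ b = b' := by
  -- acting on `ℍ`, `δ₀^(m - n)` is trivial
  have hact : ∀ σ : ℍ, ((δ₀ ^ (m - n) : Gamma0 N) : SL(2, ℤ)) • σ = σ := by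
    intro σ
    have e : ∀ (c : Bool) (k : ℤ) (σ : ℍ),
        (((if c then negOne * δ₀ ^ k else δ₀ ^ k : Gamma0 N)) : SL(2, ℤ)) • σ = ((δ₀ ^ k : Gamma0 N) : SL(2, ℤ)) • σ := by
      intro c k σ
      cases c
      · rfl
      · simp only [ite_true, Subgroup.coe_mul, coe_negOne, neg_one_mul, ModularGroup.SL_neg_smul]
    have h1 := e b m (((δ₀ ^ (-n) : Gamma0 N) : SL(2, ℤ)) • σ)
    rw [h, e b' n, ← mul_smul, ← mul_smul, ← Subgroup.coe_mul, ← Subgroup.coe_mul, ← zpow_add, ← zpow_add,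
      add_neg_cancel, zpow_zero, Subgroup.coe_one, one_smul, ← sub_eq_add_neg] at h1
    exact h1.symm
  have hmn : m = n := by
    have := zpow_eq_zero_of_forall hξ hκ hκ1 hw hact
    omega
  subst hmn
  refine ⟨rfl, ?_⟩
  -- then `b = b'` since `negOne * δ₀^m ≠ δ₀^m`
  by_contra hbb
  have hneg : negOne * δ₀ ^ m = δ₀ ^ m := by
    cases b <;> cases b' <;> simp_all
  have : (negOne : Gamma0 N) = 1 := by
    have := congrArg (· * (δ₀ ^ m)⁻¹) hneg
    simpa using this
  have h2 : ((negOne : Gamma0 N) : SL(2, ℤ)) = 1 := by rw [this]; rfl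
  rw [coe_negOne] at h2
  have h3 := congrArg (fun g : SL(2, ℤ) ↦ (g 0 0 : ℤ)) h2
  simp at h3

end Dbar

section Count

variable {ξ₁ ξ₂ κ ε : ℝ} {δ₀ : Gamma0 N}
variable (hξ : ξ₂ < ξ₁) (hκ : 0 < κ) (hκ1 : κ ≠ 1)
  (hw : ∀ z : ℂ, 0 < z.im →
    (moebius (δ₀ : SL(2, ℤ)) z - ξ₁) / (moebius (δ₀ : SL(2, ℤ)) z - ξ₂) = κ * ((z - ξ₁) / (z - ξ₂)))
include hξ hκ hκ1 hw

omit hξ hκ hκ1 hw in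
/-- **Exactly one shift of a real number by an integer multiple of `ℓ ≠ 0` lands in `[0, |ℓ|)`.** [folklore] -/
theorem existsUnique_add_mul_mem_Ico {ℓ : ℝ} (hℓ : ℓ ≠ 0) (ρ : ℝ) :
    ∃! n : ℤ, ρ + n * ℓ ∈ Ico (0 : ℝ) |ℓ| := by
  have hℓa : 0 < |ℓ| := abs_pos.mpr hℓ
  set m : ℤ := ⌊ρ / |ℓ|⌋ with hm
  obtain ⟨n, hn⟩ : ∃ n : ℤ, (n : ℝ) * ℓ = -(m : ℝ) * |ℓ| := by
    rcases lt_or_gt_of_ne hℓ with h | h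
    · exact ⟨m, by rw [abs_of_neg h]; ring⟩
    · exact ⟨-m, by rw [abs_of_pos h]; push_cast; ring⟩
  have h1 : (0 : ℝ) ≤ ρ / |ℓ| - m := by rw [hm]; linarith [Int.floor_le (ρ / |ℓ|)]
  have h2 : ρ / |ℓ| - m < 1 := by rw [hm]; linarith [Int.lt_floor_add_one (ρ / |ℓ|)]
  have hmem : ρ + n * ℓ ∈ Ico (0 : ℝ) |ℓ| := by
    rw [hn]
    have e : ρ + -(m : ℝ) * |ℓ| = (ρ / |ℓ| - m) * |ℓ| := by field_simp; ring
    rw [e]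
    exact ⟨mul_nonneg h1 hℓa.le, by nlinarith⟩
  refine ⟨n, hmem, fun n' hn' ↦ ?_⟩
  -- two solutions differ by less than one period
  have hd : |((n' : ℝ) - n) * ℓ| < |ℓ| := by
    rw [show ((n' : ℝ) - n) * ℓ = (ρ + n' * ℓ) - (ρ + n * ℓ) by ring, abs_lt]
    constructor <;> linarith [hmem.1, hmem.2, hn'.1, hn'.2]
  rw [abs_mul, mul_lt_iff_lt_one_left hℓa] at hd
  have h3 : |((n' - n : ℤ) : ℝ)| < 1 := by push_cast; exact hd
  rw [← Int.cast_abs, ← Int.cast_one, Int.cast_lt] at h3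
  have h4 : n' - n = 0 := by
    rw [abs_lt] at h3
    omega
  omega

/-- **Counting over `A₀ = {±δ₀ⁿ}`**: for any exponent function `ν` (`a` acts as `δ₀^{ν(a)}`) and any
`ρ`, exactly two elements `a ∈ A₀` (namely `±δ₀^{n₀}`) have `ρ + ν(a)ℓ ∈ [0, |ℓ|)`. [folklore] -/
theorem tsum_indicator_axisSubgroup (ρ : ℝ) (ν : axisSubgroup δ₀ → ℤ)
    (hν : ∀ (a : axisSubgroup δ₀) {z : ℂ}, 0 < z.im →
      moebius ((a : Gamma0 N) : SL(2, ℤ)) z = moebius ((δ₀ ^ ν a : Gamma0 N) : SL(2, ℤ)) z) :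
    ∑' a : axisSubgroup δ₀, (Ico (0 : ℝ) |Real.log κ|).indicator (fun _ ↦ (1 : ℂ)) (ρ + ν a * Real.log κ) = 2 := by
  set ℓ : ℝ := Real.log κ with hℓ
  have hℓ0 : ℓ ≠ 0 := fun h ↦ hκ1 (Real.eq_one_of_pos_of_log_eq_zero hκ h)
  -- the parametrisation `ℤ × Bool → A₀`
  set e : ℤ × Bool → axisSubgroup δ₀ := fun p ↦
    ⟨if p.2 then negOne * δ₀ ^ p.1 else δ₀ ^ p.1, ⟨p.1, by cases p.2 <;> simp⟩⟩ with he
  have hebij : Function.Bijective e := by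
    constructor
    · rintro ⟨m, b⟩ ⟨n, b'⟩ h
      have h' := congrArg (fun a : axisSubgroup δ₀ ↦ (a : Gamma0 N)) h
      simp only [he] at h'
      obtain ⟨hmn, hbb⟩ := zpow_exponent_unique hξ hκ hκ1 hw h'
      rw [hmn, hbb]
    · rintro ⟨a, n, ha | ha⟩
      · exact ⟨(n, false), Subtype.ext (by simp [he, ha])⟩
      · exact ⟨(n, true), Subtype.ext (by simp [he, ha])⟩
  -- the exponent of `e (n, b)` is `n`
  have hνe : ∀ p : ℤ × Bool, ν (e p) = p.1 := by
    rintro ⟨n, b⟩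
    have hact : ∀ σ : ℍ, ((δ₀ ^ (n - ν (e (n, b))) : Gamma0 N) : SL(2, ℤ)) • σ = σ := by
      intro σ
      have h1 : moebius (((e (n, b) : axisSubgroup δ₀) : Gamma0 N) : SL(2, ℤ)) (σ : ℂ) =
          moebius ((δ₀ ^ n : Gamma0 N) : SL(2, ℤ)) (σ : ℂ) := by
        cases b
        · rfl
        · simp only [he, ite_true, Subgroup.coe_mul, coe_negOne, neg_one_mul, moebius_neg _ σ.im_pos]
      have h2 := hν (e (n, b)) σ.im_pos
      rw [h1] at h2
      -- `δ₀^n σ = δ₀^ν σ`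
      have h3 : ((δ₀ ^ n : Gamma0 N) : SL(2, ℤ)) • σ = ((δ₀ ^ ν (e (n, b)) : Gamma0 N) : SL(2, ℤ)) • σ := by
        apply UpperHalfPlane.ext
        rw [coe_smul_eq_moebius, coe_smul_eq_moebius, h2]
      have h4 : ((δ₀ ^ (-ν (e (n, b))) : Gamma0 N) : SL(2, ℤ)) • ((δ₀ ^ n : Gamma0 N) : SL(2, ℤ)) • σ =
          ((δ₀ ^ (-ν (e (n, b))) : Gamma0 N) : SL(2, ℤ)) • ((δ₀ ^ ν (e (n, b)) : Gamma0 N) : SL(2, ℤ)) • σ := by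
        rw [h3]
      rw [← mul_smul, ← mul_smul, ← Subgroup.coe_mul, ← Subgroup.coe_mul, ← zpow_add, ← zpow_add,
        neg_add_cancel, zpow_zero, Subgroup.coe_one, one_smul] at h4
      rw [sub_eq_neg_add]; exact h4
    have := zpow_eq_zero_of_forall hξ hκ hκ1 hw hact
    omega
  rw [← (Equiv.ofBijective e hebij).tsum_eq]
  simp_rw [Equiv.ofBijective_apply, hνe]
  -- now a sum over `ℤ × Bool` of a function of the first coordinate supported at `n₀`
  obtain ⟨n₀, hn₀, huniq⟩ := existsUnique_add_mul_mem_Ico hℓ0 ρ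
  have hne : ((n₀, false) : ℤ × Bool) ≠ (n₀, true) := by simp
  rw [tsum_eq_sum (s := {(n₀, false), (n₀, true)})]
  · rw [Finset.sum_pair hne]
    simp only [indicator_of_mem hn₀]
    norm_num
  · rintro ⟨n, b⟩ hnb
    apply indicator_of_notMem
    intro hmem
    have := huniq n hmem
    subst this
    cases b <;> simp_all

end Count

section Periodisation

variable {ξ₁ ξ₂ κ ε : ℝ} {δ₀ : Gamma0 N}
variable (hξ : ξ₂ < ξ₁) (hκ : 0 < κ) (hκ1 : κ ≠ 1)
  (hw : ∀ z : ℂ, 0 < z.im →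
    (moebius (δ₀ : SL(2, ℤ)) z - ξ₁) / (moebius (δ₀ : SL(2, ℤ)) z - ξ₂) = κ * ((z - ξ₁) / (z - ξ₂)))
  (hε : 0 < ε) (hε' : ε < π / 2)
include hξ hκ hκ1 hw hε hε'

omit hκ hκ1 hw in
/-- **Finiteness of the periodisation**: for fixed `z`, only finitely many `γ ∈ Γ₀(N)` move `z`
into the period box (where the cut-off `𝟙_{[0,|ℓ|)}(log|w|) b'(arg w)` is supported). [folklore] -/
theorem finite_support_periodisation {z : ℂ} (hz : 0 < z.im) :
    (Function.support fun γ : Gamma0 N ↦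
      (Ico (0 : ℝ) |Real.log κ|).indicator (fun _ ↦ (1 : ℂ))
          (Real.log ‖(moebius (γ : SL(2, ℤ)) z - ξ₁) / (moebius (γ : SL(2, ℤ)) z - ξ₂)‖) *
        (I * ((deriv (fun θ : ℝ ↦ Real.smoothTransition ((θ - (π / 2 - ε)) / (2 * ε)))
          (Complex.arg ((moebius (γ : SL(2, ℤ)) z - ξ₁) / (moebius (γ : SL(2, ℤ)) z - ξ₂))) : ℝ) : ℂ) *
          conj (stripDeriv ξ₁ ξ₂ (γ : SL(2, ℤ)) z))).Finite := by
  set K₀ := (fun ζ : ℂ ↦ UpperHalfPlane.ofComplex ((ξ₂ * Complex.exp ζ - ξ₁) / (Complex.exp ζ - 1))) ''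
      ((Icc (0 : ℝ) |Real.log κ|) ×ℂ (Icc (π / 2 - ε) (π / 2 + ε))) with hK₀
  have hK₀c : IsCompact K₀ := isCompact_periodBox hξ hε' _
  have hfin := finite_setOf_smul_image_inter_nonempty (isCompact_singleton (x := UpperHalfPlane.ofComplex z)) hK₀c
  refine (Set.Finite.preimage Subtype.val_injective.injOn hfin).subset fun γ hγ ↦ ?_
  rw [Function.mem_support, mul_ne_zero_iff, mul_ne_zero_iff, mul_ne_zero_iff] at hγ
  obtain ⟨hχ, ⟨-, hb⟩, -⟩ := hγ
  -- `log|w(γz)| ∈ [0, |ℓ|)` and `arg w(γz)` in the band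
  have hρ : Real.log ‖(moebius (γ : SL(2, ℤ)) z - ξ₁) / (moebius (γ : SL(2, ℤ)) z - ξ₂)‖ ∈ Ico (0 : ℝ) |Real.log κ| := by
    by_contra h; exact hχ (indicator_of_notMem h _)
  have hθ : Complex.arg ((moebius (γ : SL(2, ℤ)) z - ξ₁) / (moebius (γ : SL(2, ℤ)) z - ξ₂)) ∈
      Icc (π / 2 - ε) (π / 2 + ε) := by
    by_contra h
    exact hb (by rw [HypStrip.deriv_band_eq_zero hε h]; simp)
  -- hence `γ z ∈ K₀`
  have hσ : ((γ : SL(2, ℤ)) • UpperHalfPlane.ofComplex z : ℍ) ∈ K₀ := by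
    have hz' := moebius_im_pos (γ : SL(2, ℤ)) hz
    refine ⟨Complex.log ((moebius (γ : SL(2, ℤ)) z - ξ₁) / (moebius (γ : SL(2, ℤ)) z - ξ₂)), ⟨?_, ?_⟩, ?_⟩
    · rw [Set.mem_preimage, Complex.log_re]; exact Ico_subset_Icc_self hρ
    · rw [Set.mem_preimage, Complex.log_im]; exact hθ
    · simp only
      rw [HypStrip.zInv_log_w hξ hz', smul_ofComplex _ hz]
  exact ⟨_, ⟨UpperHalfPlane.ofComplex z, rfl, rfl⟩, hσ⟩

/-- **The `Γ₀(N)`-periodisation of the cut-off `2∂B₀/∂z̄` is `2 ∂U/∂z̄`.** For `im z > 0`: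
`∑_{γ ∈ Γ₀(N)} 𝟙_{[0,|ℓ|)}(log|w(γz)|) · i b'(arg w(γz)) · \overline{ζ'(γz) γ'(z)} = 2 (U'(z)(1) + i U'(z)(i))`.
Group the sum along the cosets `c = gA₀` (`γ = a g⁻¹`, `a ∈ A₀ = {±δ₀ⁿ}`): the factor
`i b'(arg w) \overline{ζ' dz}` is `A₀`-invariant (`stripDeriv_mul_of_eq`), the cut-off selects
exactly one `n` and both signs (`tsum_indicator_axisSubgroup`), and
`i b'(arg w(g⁻¹z)) \overline{(ζ ∘ g⁻¹)'(z)} = (B₀∘g⁻¹)'(z)(1) + i (B₀∘g⁻¹)'(z)(i)` (`bandPiece_dbar`). [folklore] -/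
theorem tsum_periodisation_eq (τ₀ : ℍ) {z : ℂ} (hz : 0 < z.im) :
    ∑' γ : Gamma0 N,
      (Ico (0 : ℝ) |Real.log κ|).indicator (fun _ ↦ (1 : ℂ))
          (Real.log ‖(moebius (γ : SL(2, ℤ)) z - ξ₁) / (moebius (γ : SL(2, ℤ)) z - ξ₂)‖) *
        (I * ((deriv (fun θ : ℝ ↦ Real.smoothTransition ((θ - (π / 2 - ε)) / (2 * ε)))
          (Complex.arg ((moebius (γ : SL(2, ℤ)) z - ξ₁) / (moebius (γ : SL(2, ℤ)) z - ξ₂))) : ℝ) : ℂ) *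
          conj (stripDeriv ξ₁ ξ₂ (γ : SL(2, ℤ)) z)) =
      2 * (((dualPotentialDeriv δ₀ ξ₁ ξ₂ ε z 1 : ℝ) : ℂ) + I * ((dualPotentialDeriv δ₀ ξ₁ ξ₂ ε z I : ℝ) : ℂ)) := by
  -- notation
  set ℓ : ℝ := Real.log κ with hℓ
  set χ : ℝ → ℂ := fun t ↦ (Ico (0 : ℝ) |ℓ|).indicator (fun _ ↦ (1 : ℂ)) t with hχ
  set P : SL(2, ℤ) → ℂ := fun t ↦ I * ((deriv (fun θ : ℝ ↦ Real.smoothTransition ((θ - (π / 2 - ε)) / (2 * ε)))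
      (Complex.arg ((moebius t z - ξ₁) / (moebius t z - ξ₂))) : ℝ) : ℂ) * conj (stripDeriv ξ₁ ξ₂ t z) with hP
  set ρ : SL(2, ℤ) → ℝ := fun t ↦ Real.log ‖(moebius t z - ξ₁) / (moebius t z - ξ₂)‖ with hρ
  set kf : Gamma0 N → ℂ := fun γ ↦ χ (ρ (γ : SL(2, ℤ))) * P (γ : SL(2, ℤ)) with hkf
  show ∑' γ : Gamma0 N, kf γ = _
  -- (1) the right-hand side as a finite sum over cosets
  obtain ⟨E, r, hr, hU, hE⟩ := exists_finset_ball hξ hκ hκ1 hw hε hε' τ₀ hz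
  have hzb : z ∈ Metric.ball z r := Metric.mem_ball_self hr
  have hPc : ∀ c : Gamma0 N ⧸ axisSubgroup δ₀,
      ((bandPiece ξ₁ ξ₂ ε ((((Quotient.out c : Gamma0 N)) : SL(2, ℤ)))⁻¹ z 1 : ℝ) : ℂ) +
        I * ((bandPiece ξ₁ ξ₂ ε ((((Quotient.out c : Gamma0 N)) : SL(2, ℤ)))⁻¹ z I : ℝ) : ℂ) =
      P (((((Quotient.out c : Gamma0 N)) : SL(2, ℤ)))⁻¹) := fun c ↦ bandPiece_dbar _ _
  have hRHS : ((dualPotentialDeriv δ₀ ξ₁ ξ₂ ε z 1 : ℝ) : ℂ) + I * ((dualPotentialDeriv δ₀ ξ₁ ξ₂ ε z I : ℝ) : ℂ) =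
      ∑' c : Gamma0 N ⧸ axisSubgroup δ₀, P (((((Quotient.out c : Gamma0 N)) : SL(2, ℤ)))⁻¹) := by
    rw [tsum_eq_sum (s := E)]
    · rw [dualPotentialDeriv_eq_sum hξ τ₀ hU hE hzb, FunLike.coe_sum, Finset.sum_apply, Finset.sum_apply,
        Complex.ofReal_sum, Complex.ofReal_sum, Finset.mul_sum, ← Finset.sum_add_distrib]
      exact Finset.sum_congr rfl fun c _ ↦ hPc c
    · intro c hc
      rw [← hPc c, bandPiece_eq_zero_of_not_mem hξ τ₀ hU hE hzb hc]
      simp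
  rw [hRHS]
  -- (2) regroup the left-hand side along `pr γ = ⟦γ⁻¹⟧`
  set pr : Gamma0 N → Gamma0 N ⧸ axisSubgroup δ₀ := fun γ ↦ ((γ⁻¹ : Gamma0 N) : Gamma0 N ⧸ axisSubgroup δ₀) with hpr
  have hsupp : (Function.support kf).Finite := finite_support_periodisation hξ hε hε' hz
  rw [← (Equiv.sigmaFiberEquiv pr).tsum_eq]
  have h₂ : Summable fun x : Σ c, {γ // pr γ = c} ↦ kf (Equiv.sigmaFiberEquiv pr x) := by
    refine summable_of_hasFiniteSupport ?_
    show (Function.support (kf ∘ Equiv.sigmaFiberEquiv pr)).Finite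
    rw [Function.support_comp_eq_preimage]
    exact hsupp.preimage (Equiv.sigmaFiberEquiv pr).injective.injOn
  have h₁ : ∀ c, Summable fun γ' : {γ // pr γ = c} ↦ kf (Equiv.sigmaFiberEquiv pr ⟨c, γ'⟩) := by
    intro c
    refine summable_of_hasFiniteSupport ?_
    show (Function.support (kf ∘ fun γ' : {γ // pr γ = c} ↦ (γ' : Gamma0 N))).Finite
    rw [Function.support_comp_eq_preimage]
    exact hsupp.preimage Subtype.val_injective.injOn
  rw [Summable.tsum_sigma' h₁ h₂, tsum_mul_left.symm]
  · refine tsum_congr fun c ↦ ?_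
    -- (3) the fibre of `c` is parametrised by `A₀`: `a ↦ a g⁻¹`, `g = c.out`
    set g : Gamma0 N := Quotient.out c with hg
    have hgc : (g : Gamma0 N ⧸ axisSubgroup δ₀) = c := by rw [hg]; exact QuotientGroup.out_eq' c
    have hmemπ : ∀ a : axisSubgroup δ₀, pr ((a : Gamma0 N) * g⁻¹) = c := by
      intro a
      simp only [hpr, mul_inv_rev, inv_inv]
      rw [← hgc, QuotientGroup.eq]
      simp
    set φ : axisSubgroup δ₀ → {γ // pr γ = c} := fun a ↦ ⟨(a : Gamma0 N) * g⁻¹, hmemπ a⟩ with hφ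
    have hφbij : Function.Bijective φ := by
      constructor
      · intro a a' h
        have := congrArg (fun x : {γ // pr γ = c} ↦ (x : Gamma0 N) * g) h
        simpa [hφ] using this
      · rintro ⟨γ, hγ⟩
        have hmem : γ * g ∈ axisSubgroup δ₀ := by
          simp only [hpr] at hγ
          rw [← hgc, QuotientGroup.eq, inv_inv] at hγ
          exact hγ
        exact ⟨⟨γ * g, hmem⟩, Subtype.ext (by simp [hφ])⟩
    rw [← (Equiv.ofBijective φ hφbij).tsum_eq]
    simp only [Equiv.ofBijective_apply, Equiv.sigmaFiberEquiv_apply, hφ]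
    -- (4) each term: `kf (a g⁻¹) = χ(ρ(g⁻¹) + ν(a) ℓ) P(g⁻¹)`
    have hν := fun a : axisSubgroup δ₀ ↦ exists_zpow_of_mem (δ₀ := δ₀) a.2
    choose ν hνa using hν
    have hterm : ∀ a : axisSubgroup δ₀, kf ((a : Gamma0 N) * g⁻¹) =
        χ (ρ ((g : SL(2, ℤ)))⁻¹ + ν a * ℓ) * P ((g : SL(2, ℤ)))⁻¹ := by
      intro a
      have hcoe : (((a : Gamma0 N) * g⁻¹ : Gamma0 N) : SL(2, ℤ)) = ((a : Gamma0 N) : SL(2, ℤ)) * ((g : SL(2, ℤ)))⁻¹ := by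
        simp
      simp only [hkf, hcoe]
      congr 1
      · simp only [hρ]
        have h := congrArg Complex.re (log_w_moebius_mul_of_eq hξ hκ hw (hνa a) ((g : SL(2, ℤ)))⁻¹ hz)
        rw [Complex.log_re, Complex.add_re, Complex.log_re] at h
        rw [h]
        congr 1
        simp [hℓ]
      · simp only [hP]
        have h := congrArg Complex.im (log_w_moebius_mul_of_eq hξ hκ hw (hνa a) ((g : SL(2, ℤ)))⁻¹ hz)
        rw [Complex.log_im, Complex.add_im, Complex.log_im] at h
        have him0 : ((ν a : ℂ) * (Real.log κ : ℂ)).im = 0 := by simp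
        rw [him0, add_zero] at h
        rw [h, stripDeriv_mul_of_eq hξ hκ hw (hνa a) _ hz]
    simp_rw [hterm]
    rw [tsum_mul_right, tsum_indicator_axisSubgroup hξ hκ hκ1 hw _ ν (fun a ↦ hνa a), mul_comm]

end Periodisation

end DualForm

end Literature.NumberTheory.EllipticCurves.ModularForms

end
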